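import Mathlib
import HarnessLib

/-!
# Large cuts with one-round local algorithms on triangle-free regular graphs (Hirvonen–Rybicki–Schmid–Suomela 2017, Lemmas 1–3; Hastings 2019, §3.3)

Topic `Literature/Combinatorics/SimpleGraph` (pub-qadeq lane; companion of `RandomCutBaseline.lean`
and `LocalSearchMaxCut.lean`). A ONE-ROUND randomised local algorithm for large cuts: every node draws
one uniform random bit `c(v)`, counts its like-minded neighbours `ℓ_c(v) = #{u ∼ v : c(u) = c(v)}`,
and outputs a bit that depends only on the local view `(c(v), ℓ_c(v))` (and, for randomised rules,
on private coins). On a `d`-regular TRIANGLE-FREE graph the two views across an edge have a joint law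
that does not depend on the graph (HRSS Lemma 1), so the expected cut weight of any such rule is a
number `w_𝒩(𝒜)` computed on a `(2d+2)`-node weighted “neighbourhood graph” (HRSS Lemma 2); for the
threshold rule `𝒜_τ` (“change your mind if at least `τ` neighbours agree with you”) it is HRSS's
closed form `α(τ,d) = ½ + 4^{−(d−1)} C(d−1,τ−1) Σ_{i=d−τ+1}^{τ−1} C(d−1,i)` (Lemma 3), and for
Hastings' spin-symmetric randomised rules with profile `q` it is `½ + ¼(A_q² − B_q²)` (Hastings 2019,
§3.3). These are the classical local algorithms that Hastings compares with the level-1 QAOA on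
triangle-free MaxCut; the comparison itself (which imports the QAOA files) is the sequel
`Literature/Computability/QuantumComplexity/QAOAVersusThreshold.lean`.

HONEST FRAMING (pub-qadeq lane context — the QAOA / MaxCut rows of the register and the sentence
“QAOA₁ improves upon the currently known best classical approximation algorithm for these graphs”
that Hastings refutes): instance-level adjudication of specific advantage claims; no claim about BQP
vs BPP or the summit. This file proves exact finite identities about one-round classical rules; it
says nothing about any quantum device, about QAOA at depth `p ≥ 2`, or about non-local classical
algorithms (Goemans–Williamson etc.).

## Sources (held texts, read at the cited places)

* [HirvonenRybickiSchmidSuomela2017] J. Hirvonen, J. Rybicki, S. Schmid, J. Suomela, *Large cuts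
  with local algorithms on triangle-free graphs*, Electron. J. Combin. 24(4) (2017) P4.21 =
  arXiv:1402.2543 (`lit read arxiv:1402.2543`, tex chunks p0002–p0006). §1.1: “A cut is a function
  `c : V → {a, b}` … An edge `{u,v} ∈ E` is a cut edge if `c(u) ≠ c(v)`. … the weight `w(c)` of a
  cut `c` is the fraction of edges that are cut edges”. §1.3 (Shearer's algorithm), eq. (1): “`c(v) =
  c₁(v)` if `ℓ(v) < d/2`; `c₁(v)` if `ℓ(v) = d/2` and `c₃(v) = 0`; `c₂(v)` if `ℓ(v) = d/2` and `c₃(v)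
  = 1`; `c₂(v)` if `ℓ(v) > d/2`”, eq. (2): “at least `½ + √2/(8√d) ≈ ½ + 0.177/√d`”. §1.4, eq. (3):
  “`τ = ⌈(d + √d)/2⌉`”, eq. (4): “`c(v) = c₁(v)` if `ℓ(v) < τ`, the complement of `c₁(v)` if `ℓ(v)
  ≥ τ`”, eq. (5): “at least `½ + 9/(32√d) = ½ + 0.28125/√d` … As a corollary, any `d`-regular
  triangle-free graph admits a cut of at least this size.” §2.2: “The local neighbourhood of a node
  `v` is `N_c(v) = (c(v), ℓ_c(v))`, where `ℓ_c(v) = |{v,u} ∈ E : c(v) = c(u)|` … there are only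
  `2d+2` possible local neighbourhoods. A distributed algorithm is a function `𝒜` that associates an
  output `𝒜(N) ∈ {a,b}` with each local neighbourhood `N` … Pick a uniform random cut `c`. For each
  node `v`, let `c'(v) = 𝒜(N_c(v))` … we are interested in the quantity `𝔼[w(𝒜(G))]`”. §2.3: “The
  weight of cut `c` is `w(c) = Σ_{(u,v) ∈ V×V, c(u) ≠ c(v)} w(u,v)`”, “`V_𝒩 = {(k,i) : k ∈ {a,b}, i
  ∈ {0,1,…,d}}`”, “`w_𝒩((k₁,i₁),(k₂,i₂)) = 4^{−d} C(d−1,i₁) C(d−1,i₂)` if `k₁ ≠ k₂`, `4^{−d}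
  C(d−1,i₁−1) C(d−1,i₂−1)` if `k₁ = k₂`. We follow the convention that `C(n,k) = 0` for `k < 0` and
  `k > n`.” **Lemma 1.** “Let `G` be a `d`-regular triangle-free graph, and let `{u,v}` be an edge of
  `G`. Consider a uniform random cut `c` of `G`. Then for any given neighbourhoods `N₁, N₂ ∈ V_𝒩` we
  have `Pr[N_c(u) = N₁ and N_c(v) = N₂] = w_𝒩(N₁,N₂)`” (proof: “As `G` is triangle-free, sets `S_u`
  and `S_v` are disjoint. In particular, the random variables `c(x)` for `x ∈ S_u ∪ S_v` are
  independent … `= ¼ · 2^{−(d−1)} C(d−1,i₁−1) · 2^{−(d−1)} C(d−1,i₂−1)`”). §2.4 **Lemma 2.** “If `𝒜 :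
  V_𝒩 → {a,b}` is a cut in neighbourhood graph `𝒩`, and `G` is a `d`-regular triangle-free graph,
  then `𝔼[w(𝒜(G))] = w_𝒩(𝒜)`” (proof: “`w_𝒩(𝒜) = Σ_{𝒜(N₁)≠𝒜(N₂)} w_𝒩(N₁,N₂) = … = Pr[𝒜(N_c(u)) ≠
  𝒜(N_c(v))]`. The claim follows by summing over all edges”). §2.5, eq. (5)/(6) and Remark 1: “For `d
  = 3`, the heaviest cut … `𝒜_τ((k,i)) = k` if `i < τ`, the complement if `i ≥ τ` … Note that `τ₃ =
  3`.” §2.6 **Lemma 3.** “For all `d` and `τ > d/2` we have `α(τ,d) = ½ + 4^{−(d−1)} C(d−1,τ−1)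
  Σ_{i=d−τ+1}^{τ−1} C(d−1,i)`” (proof via `p, q, r`, “`2^{d−1}(r_u − p_u) = C(d−1,τ−1)`,
  `2^{d−1}(q_u − r_u) = Σ_{i=0}^{τ−1} − Σ_{i=0}^{d−τ} = Σ_{i=d−τ+1}^{τ−1} C(d−1,i)`”). **Theorem 4.**
  “Let `d ≥ 2` and `τ = ⌈(d+√d)/2⌉`. Then `α(τ,d) ≥ ½ + 9/(32√d)`” (Appendix A: “Verify cases `d =
  2,3,…,3000` with a computer. Prove a closed-form lower bound for `d > 3000`”).
* [Hastings2019BoundedDepth] M. B. Hastings, *Classical and Quantum Bounded Depth Approximation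
  Algorithms*, Quantum Inf. Comput. 19 (2019) 1116 = arXiv:1905.07047 (`lit read arxiv:1905.07047`,
  tex chunks p0009–p0011). §3: “Each vertex `i` of the graph corresponds to a spin `σ_i = ±1`, with
  the sign of the spin determining the cut”; “the algorithm consists of randomly assigning each spin
  to a cut. Then, for each spin, if sufficiently many neighbors agree with the spin …, the given spin
  changes to which cut it is assigned … This threshold is denoted `τ`. We will refer to this algorithm
  as the ‘threshold algorithm’”. §3.1: “we can instead take a ‘soft threshold’, where the spin has
  some probability of flipping depending on the number of neighbors which agree”. §3.3: “Since the
  graph is triangle-free, the subgraph consisting of neighboring spins `i,j` and their neighbors is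
  the same in all cases … if `j` neighbors agree then the value of the spin is chosen from a
  distribution on `{−1,+1}` with expectation value equal to `q(j) (v₀)_j`, with `q(j) ∈ [−1,+1]`. The
  threshold algorithm has `q(j) ∈ {−1,+1}` for all `j` … In the first case [`(v₀)_i = (v₀)_j`] … the
  expectation value of `Z_i Z_j` is equal to `(Σ_{n=0}^{D−1} 2^{−(D−1)} C(D−1,n) q(n+1))²` … In the
  second case … `−(Σ_{n=0}^{D−1} 2^{−(D−1)} C(D−1,n) q(n))²`. So, averaging over choices of `(v₀)_i,
  (v₀)_j`, the expectation value of `−½ Z_i Z_j` equals `¼[(Σ_n 2^{−(D−1)} C(D−1,n) q(n))² − (Σ_n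
  2^{−(D−1)} C(D−1,n) q(n+1))²]`.” (The bib key `Hastings2019` of `references.bib` is a DIFFERENT
  2019 paper of Hastings, arXiv:1907.12724; this file cites the bounded-depth paper under the key
  `Hastings2019BoundedDepth`.)

## What is formalised (all proved, 0 named facts)

Probability is finite and explicit: the algorithm's randomness is a uniform colouring `c : V → Bool`
and independent uniform private symbols `r : V → R` (`R` any nonempty finite type; `R = Unit` for
HRSS's deterministic rules, `Bool × Bool` for Shearer's rule, `Fin 20` for Hastings' soft thresholds),
and `𝔼` is the plain average `unifAvg` over the finite product space. Section `Toolkit` proves the two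
probabilistic inputs of HRSS's proofs in this setting: INDEPENDENCE of functions reading disjoint
coordinate sets (`unifAvg_mul_of_disjoint`, via the measure-preserving involution `mixEquiv` that
swaps the `S`-parts of a pair of configurations) and the BINOMIAL law of the number of `k`-coloured
coordinates in a fixed set (`unifAvg_cnt_eq`, by induction on the set with Pascal's rule), plus the
uniform marginals of one and two coordinates (`unifAvg_indicator_apply`, `unifAvg_apply_two`) and the
probabilistic method (`exists_unifAvg_le`).

* Model (§2.2): `likeMinded G c v = ℓ_c(v)`, `view G c v = N_c(v)`, `Rule R` (output bit from the
  view and the private symbol), `run` (the produced cut `c'`), `expect`, `cutProb` (probability that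
  the two outputs on an edge differ), `IsCut` / `cutCount` / `cutWeight` (§1.1), `expCutCount`,
  `expCutWeight = 𝔼[w(𝒜(G))]`; §2.3: `viewWeight d = w_𝒩` (with `choosePred n i = C(n, i−1)`,
  `C(n,−1) = 0`), `views d = V_𝒩`, `disagree` (probability that the outputs on two given views
  differ; the indicator `𝒜(N₁) ≠ 𝒜(N₂)` for deterministic rules), `ngraphWeight d A = w_𝒩(𝒜)`.
* **Lemma 1** `prob_views_eq` (hypotheses exactly as used in the proof: `u ∼ v`, `deg u = deg v =
  d`, `N(u) ∩ N(v) = ∅`; `disjoint_neighborFinset_of_cliqueFree` derives the last from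
  triangle-freeness, `likeMinded_eq` is “`ℓ_c(u) = [c(v)=c(u)] + #{y ∈ S_u : c(y) = c(u)}`”).
* **Lemma 2** `cutProb_eq_ngraphWeight` (per edge), `expCutCount_eq` (`𝔼[#cut edges] = |E| ·
  w_𝒩(𝒜)` on every `d`-regular triangle-free graph, via `expCutCount_eq_sum` = linearity of
  expectation and `Sym2` bookkeeping), `expCutWeight_eq` (`𝔼[w(𝒜(G))] = w_𝒩(𝒜)`), and the
  existence corollary `exists_cutCount_ge` (“any `d`-regular triangle-free graph admits a cut of at
  least this size”).
* **Hastings' formula** `ngraphWeight_eq_of_symmetric`: for a rule whose mean output spin on the view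
  `(k, j)`, `j ≤ d`, is `q(j) · spin k` (`IsSymmetric`, with `meanSpin`, `spin`), `w_𝒩(𝒜) = ½ +
  ¼(hastingsA d q² − hastingsB d q²)`; `disagree_eq` is “`Pr[Z₁ ≠ Z₂] = ½(1 − 𝔼Z₁ 𝔼Z₂)`” and
  `block_identity` the algebra of one `(k₁,k₂)` block of the `V_𝒩 × V_𝒩` sum.
* **Lemma 3** `ngraphWeight_threshold` (`w_𝒩(𝒜_τ) = α(τ,d)` for `d/2 < τ`, `d ≥ 1`; `thresholdRule`,
  `thresholdQ`, `alpha`, `alphaNum`), obtained from Hastings' formula: `A_q − B_q = 2C(d−1,τ−1)/2^{d−1}`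
  (`hastingsA_sub_hastingsB_threshold`, the paper's `r_u − p_u`) and `A_q + B_q = 2Σ_{i=d−τ+1}^{τ−1}
  C(d−1,i)/2^{d−1}` (`hastingsA_add_hastingsB_threshold`, the paper's `q_u − r_u`, with the same
  reflection `i ↦ d−1−i` of the binomial row); graph level `expCutWeight_threshold`,
  `expCutCount_threshold`, `exists_cutCount_ge_alpha`.
* Shearer's rule §1.3 eq. (1) as an instance (`shearerRule`, private bits `(c₂(v), c₃(v))`) with its
  spin profile `1, ½, 0` (`shearerRule_symmetric`), so that Lemma 2 / Hastings' formula give its exact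
  performance; HRSS's threshold `hrssThreshold d = ⌈(d+√d)/2⌉` with the pinning lemma
  `hrssThreshold_eq`; **Theorem 4 for `2 ≤ d ≤ 10`** (`hrss_theorem4_small`, kernel evaluation of
  `alphaNum` and of `⌈(d+√d)/2⌉ = 2,3,3,4,5,5,6,6,7`); `alpha_two = 3/4`, `alpha_three = 11/16` (§2.5:
  `τ₃ = 3`).

* **Valued one-round rules** (section `Valued`; Hastings §3–§3.3 “local tensor algorithms” with a
  finite initial distribution: i.i.d. uniform symbols `x_v ∈ β`, integer weights `φ`, output
  `F (x_v) (Σ_{w∼v} φ(x_w))` — e.g. `Z_i = sign((v⃗₀ + c J v⃗₀)_i)` with `v⃗₀ ∈ {−1,−1/3,1/3,1}^V`):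
  `nbrSum`, `vrun`, `vcutProb`, `vexpCutCount`, `vexpCutWeight`, `localMean D φ F a b` (mean output
  spin over the `D−1` further neighbours); **`vcutProb_eq`** (`Pr[Z_u ≠ Z_v] = ½ − Σ_{a,b} m(a,b)
  m(b,a)/(2|β|²)` on an edge with `deg = D` and no common neighbour — conditional independence given
  `(x_u, x_v)` plus the transport lemma `unifAvg_sum_transport`: the law of `Σ_{w∈S} φ(x_w)` depends
  only on `|S|`), **`vexpCutCount_eq`** / `vexpCutWeight_eq` (graph level on `D`-regular triangle-free
  graphs), and the integer form for kernel evaluation `spinZ` / `localSumZ` / `pairSumZ` /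
  `localMean_eq` / **`vexpCutCount_eq_int`** (`𝔼[#cut] = |E| · (½ − pairSumZ/(2|β|^{2D}))`).

NOT formalised: Theorem 4 for `d ≥ 11` (the paper's computer check to `3000` and its Appendix-A
binomial estimates — Fact 5 / Lemmas 6–7 would need explicit-constant central-binomial bounds);
Shearer's bound `½ + √2/(8√d)` (only his rule is typed); the optimality of `𝒜_τ` among all one-round
rules for `d ≤ 32` (§2.5, a max-SAT computation); §3's extensions to maximum degree `d` and to graphs
with few triangles; Hastings' CONTINUOUS-valued local tensor algorithms of §3.2 (uniform on `[−1,1]`,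
Monte-Carlo evaluated in the paper) — only finite initial distributions are typed.
-/

noncomputable section

open Finset

namespace Literature.Combinatorics.SimpleGraph.TriangleFreeLocalCut

/-! ## Toolkit: uniform averages over product configurations `V → β` -/

section Toolkit

variable {V : Type*} {β : Type*}

/-- The uniform average of a real function over all configurations `σ : V → β` (the expectation
under independent uniform coordinates). [folklore] -/
def unifAvg [Fintype V] [DecidableEq V] [Fintype β] (f : (V → β) → ℝ) : ℝ :=
  (∑ σ : V → β, f σ) / Fintype.card (V → β)

/-- The configuration space is nonempty. [folklore] -/
private theorem card_fun_pos [Fintype V] [DecidableEq V] [Fintype β] [Nonempty β] :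
    (0 : ℝ) < Fintype.card (V → β) := by
  exact_mod_cast Fintype.card_pos

/-- Linearity of the uniform average. [folklore] -/
private theorem unifAvg_add [Fintype V] [DecidableEq V] [Fintype β] (f g : (V → β) → ℝ) :
    unifAvg (fun σ => f σ + g σ) = unifAvg f + unifAvg g := by
  simp [unifAvg, sum_add_distrib, add_div]

/-- Linearity of the uniform average. [folklore] -/
private theorem unifAvg_sub [Fintype V] [DecidableEq V] [Fintype β] (f g : (V → β) → ℝ) :
    unifAvg (fun σ => f σ - g σ) = unifAvg f - unifAvg g := by
  simp [unifAvg, sum_sub_distrib, sub_div]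

/-- Linearity of the uniform average. [folklore] -/
private theorem unifAvg_const_mul [Fintype V] [DecidableEq V] [Fintype β] (a : ℝ) (f : (V → β) → ℝ) :
    unifAvg (fun σ => a * f σ) = a * unifAvg f := by
  simp [unifAvg, ← mul_sum, mul_div_assoc]

/-- Linearity of the uniform average. [folklore] -/
private theorem unifAvg_mul_const [Fintype V] [DecidableEq V] [Fintype β] (a : ℝ) (f : (V → β) → ℝ) :
    unifAvg (fun σ => f σ * a) = unifAvg f * a := by
  simp [unifAvg, ← sum_mul, div_mul_eq_mul_div]

/-- Linearity of the uniform average. [folklore] -/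
private theorem unifAvg_div_const [Fintype V] [DecidableEq V] [Fintype β] (a : ℝ) (f : (V → β) → ℝ) :
    unifAvg (fun σ => f σ / a) = unifAvg f / a := by
  rw [unifAvg, unifAvg, ← sum_div, div_right_comm]

/-- The average of a constant. [folklore] -/
private theorem unifAvg_const [Fintype V] [DecidableEq V] [Fintype β] [Nonempty β] (a : ℝ) :
    unifAvg (fun _ : V → β => a) = a := by
  simp only [unifAvg, sum_const, card_univ, nsmul_eq_mul]
  exact mul_div_cancel_left₀ a (ne_of_gt card_fun_pos)

/-- The uniform average commutes with finite sums. [folklore] -/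
private theorem unifAvg_finset_sum [Fintype V] [DecidableEq V] [Fintype β] {ι : Type*} (s : Finset ι)
    (f : ι → (V → β) → ℝ) : unifAvg (fun σ => ∑ i ∈ s, f i σ) = ∑ i ∈ s, unifAvg (f i) := by
  simp only [unifAvg, ← sum_div]
  rw [sum_comm]

/-- Congruence for the uniform average. [folklore] -/
private theorem unifAvg_congr [Fintype V] [DecidableEq V] [Fintype β] {f g : (V → β) → ℝ}
    (h : ∀ σ, f σ = g σ) : unifAvg f = unifAvg g := by
  simp [unifAvg, h]

/-- Monotonicity of the uniform average. [folklore] -/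
private theorem unifAvg_mono [Fintype V] [DecidableEq V] [Fintype β] {f g : (V → β) → ℝ}
    (h : ∀ σ, f σ ≤ g σ) : unifAvg f ≤ unifAvg g :=
  div_le_div_of_nonneg_right (sum_le_sum fun σ _ => h σ) (Nat.cast_nonneg _)

/-- Positivity of the uniform average. [folklore] -/
private theorem unifAvg_nonneg [Fintype V] [DecidableEq V] [Fintype β] {f : (V → β) → ℝ}
    (h : ∀ σ, 0 ≤ f σ) : 0 ≤ unifAvg f :=
  div_nonneg (sum_nonneg fun σ _ => h σ) (Nat.cast_nonneg _)

/-- **The probabilistic method**: some configuration does at least as well as the average.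
[folklore] -/
private theorem exists_unifAvg_le [Fintype V] [DecidableEq V] [Fintype β] [Nonempty β]
    (f : (V → β) → ℝ) : ∃ σ, unifAvg f ≤ f σ := by
  obtain ⟨σ, -, hσ⟩ := exists_max_image (univ : Finset (V → β)) f univ_nonempty
  refine ⟨σ, ?_⟩
  unfold unifAvg
  rw [div_le_iff₀ card_fun_pos]
  calc ∑ τ, f τ ≤ ∑ _τ : V → β, f σ := sum_le_sum fun τ _ => hσ τ (mem_univ τ)
    _ = f σ * Fintype.card (V → β) := by rw [sum_const, card_univ, nsmul_eq_mul, mul_comm]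

/-- `f` depends only on the coordinates in `S`. [folklore] -/
private def DependsOn (f : (V → β) → ℝ) (S : Finset V) : Prop :=
  ∀ ⦃σ σ' : V → β⦄, (∀ x ∈ S, σ x = σ' x) → f σ = f σ'

/-- Dependence on a set is inherited by supersets. [folklore] -/
private theorem DependsOn.mono {f : (V → β) → ℝ} {S T : Finset V} (h : DependsOn f S) (hST : S ⊆ T) :
    DependsOn f T := fun _ _ hx => h fun x hxS => hx x (hST hxS)

/-- A product depends on the union of the supports. [folklore] -/
private theorem DependsOn.mul [DecidableEq V] {f g : (V → β) → ℝ} {S T : Finset V} (hf : DependsOn f S)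
    (hg : DependsOn g T) : DependsOn (fun σ => f σ * g σ) (S ∪ T) := by
  intro σ σ' h
  show f σ * g σ = f σ' * g σ'
  rw [hf fun x hx => h x (mem_union_left T hx), hg fun x hx => h x (mem_union_right S hx)]

/-- A function of one coordinate depends on that coordinate. [folklore] -/
private theorem dependsOn_apply (u : V) (φ : β → ℝ) : DependsOn (fun σ : V → β => φ (σ u)) {u} := by
  intro σ σ' h
  show φ (σ u) = φ (σ' u)
  rw [h u (mem_singleton_self u)]

/-- Overwrite the coordinates in `S` of the second configuration by those of the first. [folklore] -/
def mix [DecidableEq V] (S : Finset V) (σ σ' : V → β) : V → β :=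
  fun x => if x ∈ S then σ x else σ' x

/-- Evaluation of `mix` on `S`. [folklore] -/
@[simp] private theorem mix_apply_of_mem [DecidableEq V] {S : Finset V} {x : V} (hx : x ∈ S)
    (σ σ' : V → β) : mix S σ σ' x = σ x := if_pos hx

/-- Evaluation of `mix` off `S`. [folklore] -/
@[simp] private theorem mix_apply_of_not_mem [DecidableEq V] {S : Finset V} {x : V} (hx : x ∉ S)
    (σ σ' : V → β) : mix S σ σ' x = σ' x := if_neg hx

/-- `mix` is involutive in the sense needed for `mixEquiv`. [folklore] -/
private theorem mix_mix_mix [DecidableEq V] (S : Finset V) (σ σ' : V → β) :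
    mix S (mix S σ σ') (mix S σ' σ) = σ := by
  funext x
  by_cases hx : x ∈ S <;> simp [hx]

/-- The involution `(σ, σ') ↦ (mix_S σ σ', mix_S σ' σ)` of the square of the configuration space
(it exchanges the `S`-parts). [folklore] -/
def mixEquiv [DecidableEq V] (S : Finset V) : ((V → β) × (V → β)) ≃ ((V → β) × (V → β)) where
  toFun p := (mix S p.1 p.2, mix S p.2 p.1)
  invFun p := (mix S p.1 p.2, mix S p.2 p.1)
  left_inv p := by simp only [mix_mix_mix]
  right_inv p := by simp only [mix_mix_mix]

/-- **Independence of disjoint coordinate sets** (counted form): if `f` depends only on `S`, `g`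
only on `T`, and `S ∩ T = ∅`, then `(Σ f)(Σ g) = |β^V| · Σ f g`. [folklore] -/
private theorem sum_mul_sum_of_disjoint [Fintype V] [DecidableEq V] [Fintype β] {f g : (V → β) → ℝ}
    {S T : Finset V} (hf : DependsOn f S) (hg : DependsOn g T) (hST : Disjoint S T) :
    (∑ σ, f σ) * (∑ σ, g σ) = Fintype.card (V → β) * ∑ σ, f σ * g σ := by
  rw [sum_mul_sum, ← Fintype.sum_prod_type']
  have key : ∀ p : (V → β) × (V → β),
      f p.1 * g p.2 = f (mixEquiv S p).1 * g (mixEquiv S p).1 := by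
    intro p
    have h1 : f p.1 = f (mix S p.1 p.2) := hf fun x hx => (mix_apply_of_mem hx _ _).symm
    have h2 : g p.2 = g (mix S p.1 p.2) := hg fun x hx =>
      (mix_apply_of_not_mem (disjoint_right.1 hST hx) _ _).symm
    rw [h1, h2]
    rfl
  rw [Fintype.sum_congr _ _ key, Equiv.sum_comp (mixEquiv S) (fun p => f p.1 * g p.1),
    Fintype.sum_prod_type]
  simp only [sum_const, card_univ, nsmul_eq_mul]
  rw [mul_sum]

/-- **Independence of disjoint coordinate sets**: `𝔼[f g] = 𝔼[f] 𝔼[g]` when `f` and `g` read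
disjoint sets of (independent, uniform) coordinates. [folklore] -/
private theorem unifAvg_mul_of_disjoint [Fintype V] [DecidableEq V] [Fintype β] [Nonempty β]
    {f g : (V → β) → ℝ} {S T : Finset V}
    (hf : DependsOn f S) (hg : DependsOn g T) (hST : Disjoint S T) :
    unifAvg (fun σ => f σ * g σ) = unifAvg f * unifAvg g := by
  unfold unifAvg
  rw [div_mul_div_comm, sum_mul_sum_of_disjoint hf hg hST,
    mul_div_mul_left _ _ (ne_of_gt card_fun_pos)]

/-- Exchanging the values `a`, `a'` of one coordinate is an involution of the configuration
space. [folklore] -/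
def swapAt [DecidableEq V] [DecidableEq β] (u : V) (a a' : β) : (V → β) ≃ (V → β) where
  toFun σ := Function.update σ u (Equiv.swap a a' (σ u))
  invFun σ := Function.update σ u (Equiv.swap a a' (σ u))
  left_inv σ := by
    funext x
    by_cases hx : x = u
    · subst hx; simp
    · simp [hx]
  right_inv σ := by
    funext x
    by_cases hx : x = u
    · subst hx; simp
    · simp [hx]

/-- Each value of a single coordinate is taken by the same number of configurations.
[folklore] -/
private theorem sum_indicator_apply_eq [Fintype V] [DecidableEq V] [Fintype β] [DecidableEq β]
    (u : V) (a a' : β) :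
    ∑ σ : V → β, (if σ u = a then (1 : ℝ) else 0)
      = ∑ σ : V → β, (if σ u = a' then (1 : ℝ) else 0) := by
  rw [← Equiv.sum_comp (swapAt u a a') (fun σ : V → β => if σ u = a' then (1 : ℝ) else 0)]
  refine Fintype.sum_congr _ _ fun σ => ?_
  simp only [swapAt, Equiv.coe_fn_mk, Function.update_self, Equiv.swap_apply_eq_iff,
    Equiv.swap_apply_right]

/-- **A single uniform coordinate**: `ℙ[σ_u = a] = 1/|β|`. [folklore] -/
private theorem unifAvg_indicator_apply [Fintype V] [DecidableEq V] [Fintype β] [DecidableEq β]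
    [Nonempty β] (u : V) (a : β) :
    unifAvg (fun σ : V → β => if σ u = a then (1 : ℝ) else 0) = 1 / Fintype.card β := by
  have hβ : (0 : ℝ) < Fintype.card β := by exact_mod_cast Fintype.card_pos
  have hsum : (Fintype.card β : ℝ) * ∑ σ : V → β, (if σ u = a then (1 : ℝ) else 0)
      = Fintype.card (V → β) := by
    calc (Fintype.card β : ℝ) * ∑ σ : V → β, (if σ u = a then (1 : ℝ) else 0)
        = ∑ _a' : β, ∑ σ : V → β, (if σ u = a then (1 : ℝ) else 0) := by
          rw [sum_const, card_univ, nsmul_eq_mul]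
      _ = ∑ a' : β, ∑ σ : V → β, (if σ u = a' then (1 : ℝ) else 0) :=
          Fintype.sum_congr _ _ fun a' => sum_indicator_apply_eq u a a'
      _ = ∑ σ : V → β, ∑ a' : β, (if σ u = a' then (1 : ℝ) else 0) := sum_comm
      _ = Fintype.card (V → β) := by simp
  unfold unifAvg
  rw [div_eq_div_iff (ne_of_gt card_fun_pos) (ne_of_gt hβ), one_mul, mul_comm, hsum]

/-- **Two distinct uniform coordinates**: `𝔼[h(σ_u, σ_v)] = |β|⁻² Σ_{a,b} h(a,b)`. [folklore] -/
private theorem unifAvg_apply_two [Fintype V] [DecidableEq V] [Fintype β] [DecidableEq β] [Nonempty β]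
    {u v : V} (huv : u ≠ v) (h : β → β → ℝ) :
    unifAvg (fun σ : V → β => h (σ u) (σ v)) = (∑ a, ∑ b, h a b) / (Fintype.card β : ℝ) ^ 2 := by
  have hexp : ∀ σ : V → β, h (σ u) (σ v)
      = ∑ a, ∑ b, h a b * ((if σ u = a then (1 : ℝ) else 0) * (if σ v = b then (1 : ℝ) else 0)) := by
    intro σ
    symm
    rw [Finset.sum_eq_single (σ u)]
    · rw [Finset.sum_eq_single (σ v)]
      · simp
      · intro b _ hb; simp [Ne.symm hb]
      · simp
    · intro a _ ha; simp [Ne.symm ha]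
    · simp
  have hind : ∀ a b : β, unifAvg (fun σ : V → β =>
      (if σ u = a then (1 : ℝ) else 0) * (if σ v = b then (1 : ℝ) else 0))
      = 1 / Fintype.card β * (1 / Fintype.card β) := by
    intro a b
    rw [unifAvg_mul_of_disjoint (dependsOn_apply u fun x => if x = a then (1 : ℝ) else 0)
      (dependsOn_apply v fun x => if x = b then (1 : ℝ) else 0) (disjoint_singleton.2 huv),
      unifAvg_indicator_apply, unifAvg_indicator_apply]
  rw [unifAvg_congr hexp, unifAvg_finset_sum]
  simp_rw [unifAvg_finset_sum, unifAvg_const_mul, hind]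
  rw [sum_div]
  refine sum_congr rfl fun a _ => ?_
  rw [sum_div]
  refine sum_congr rfl fun b _ => ?_
  have hβ : (Fintype.card β : ℝ) ≠ 0 := ne_of_gt (by exact_mod_cast Fintype.card_pos)
  field_simp

/-! ### The number of coordinates of a given colour in a fixed set is binomial -/

/-- `#{y ∈ S : c y = k}`. [folklore] -/
def cnt (S : Finset V) (k : Bool) (c : V → Bool) : ℕ := #(S.filter fun y => c y = k)

/-- Counting colour-`k` coordinates in `insert y S`. [folklore] -/
private theorem cnt_insert [DecidableEq V] {S : Finset V} {y : V} (hy : y ∉ S) (k : Bool) (c : V → Bool) :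
    cnt (insert y S) k c = (if c y = k then 1 else 0) + cnt S k c := by
  unfold cnt
  rw [filter_insert]
  split_ifs with h
  · rw [card_insert_of_notMem (fun h' => hy (mem_of_mem_filter y h')), add_comm]
  · rw [zero_add]

/-- The count over `S` depends only on `S`. [folklore] -/
private theorem dependsOn_cnt (S : Finset V) (k : Bool) (φ : ℕ → ℝ) :
    DependsOn (fun c : V → Bool => φ (cnt S k c)) S := by
  intro c c' h
  simp only [cnt]
  rw [filter_congr (fun y hy => by rw [h y hy])]

/-- The count over `S` is at most `|S|`. [folklore] -/
private theorem cnt_le (S : Finset V) (k : Bool) (c : V → Bool) : cnt S k c ≤ #S := card_filter_le _ _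

/-- **Binomial marginal**: for a set `S` of coordinates of a uniform random 2-colouring,
`ℙ[#{y ∈ S : c y = k} = i] = C(|S|, i)/2^{|S|}`. [cite: HirvonenRybickiSchmidSuomela2017, §2.3
Lemma 1 (proof: “Pr[|{y ∈ S_u : c(y) = k₁}| = i₁] = 2^{−(d−1)} binom(d−1, i₁)”)] -/
theorem unifAvg_cnt_eq [Fintype V] [DecidableEq V] (S : Finset V) (k : Bool) (i : ℕ) :
    unifAvg (fun c : V → Bool => if cnt S k c = i then (1 : ℝ) else 0)
      = (S.card.choose i : ℝ) / 2 ^ S.card := by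
  induction S using Finset.induction_on generalizing i with
  | empty =>
    cases i with
    | zero => simp [cnt, unifAvg_const]
    | succ i => simp [cnt, unifAvg_const]
  | @insert y S hy ih =>
    have hsplit : ∀ c : V → Bool, (if cnt (insert y S) k c = i then (1 : ℝ) else 0)
        = (if c y = k then (1 : ℝ) else 0) * (if 1 + cnt S k c = i then (1 : ℝ) else 0)
          + (if c y = !k then (1 : ℝ) else 0) * (if cnt S k c = i then (1 : ℝ) else 0) := by
      intro c
      rw [cnt_insert hy]
      by_cases h : c y = k
      · simp [h]
      · have h' : c y = !k := by cases hc : c y <;> cases k <;> simp_all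
        simp [h']
    rw [unifAvg_congr hsplit, unifAvg_add,
      unifAvg_mul_of_disjoint (dependsOn_apply y fun x => if x = k then (1 : ℝ) else 0)
        (dependsOn_cnt S k fun n => if 1 + n = i then (1 : ℝ) else 0) (disjoint_singleton_left.2 hy),
      unifAvg_mul_of_disjoint (dependsOn_apply y fun x => if x = !k then (1 : ℝ) else 0)
        (dependsOn_cnt S k fun n => if n = i then (1 : ℝ) else 0) (disjoint_singleton_left.2 hy),
      unifAvg_indicator_apply, unifAvg_indicator_apply, ih i, card_insert_of_notMem hy,
      Fintype.card_bool]
    cases i with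
    | zero =>
      have h0 : ∀ c : V → Bool, (if 1 + cnt S k c = 0 then (1 : ℝ) else 0) = 0 := fun c => by simp
      rw [unifAvg_congr h0, unifAvg_const, Nat.choose_zero_right, Nat.choose_zero_right, pow_succ,
        Nat.cast_ofNat, Nat.cast_one]
      ring
    | succ i =>
      have h1 : ∀ c : V → Bool, (if 1 + cnt S k c = i + 1 then (1 : ℝ) else 0)
          = if cnt S k c = i then (1 : ℝ) else 0 := fun c => by
        simp [add_comm 1]
      rw [unifAvg_congr h1, ih i, Nat.choose_succ_succ', Nat.cast_add, pow_succ, Nat.cast_ofNat]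
      field_simp

end Toolkit

/-! ## One-round local algorithms on a graph (HRSS §2.2) -/

section Model

variable {V : Type*} [Fintype V] [DecidableEq V] (G : _root_.SimpleGraph V) [DecidableRel G.Adj]
variable {R : Type*}

/-- `ℓ_c(v)`, the number of like-minded neighbours of `v` in the colouring `c` (“the number of
neighbours with the same random bit”). [cite: HirvonenRybickiSchmidSuomela2017, §2.2
(“ℓ_c(v) = |{v,u} ∈ E : c(v) = c(u)|”)] -/
def likeMinded (c : V → Bool) (v : V) : ℕ := #((G.neighborFinset v).filter fun w => c w = c v)

/-- The local neighbourhood (local view) `N_c(v) = (c(v), ℓ_c(v))` of a node after one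
communication round. [cite: HirvonenRybickiSchmidSuomela2017, §2.2 (“The local neighbourhood of a
node v is N_c(v) = (c(v), ℓ_c(v))”)] -/
def view (c : V → Bool) (v : V) : Bool × ℕ := (c v, likeMinded G c v)

/-- A one-round local rule: the output bit of a node as a function of its local view `(k, ℓ)` and
of its private randomness `r ∈ R` (HRSS's deterministic algorithms `𝒜 : V_𝒩 → {a, b}` are the rules
that ignore `r`; Shearer's rule reads two further private random bits; Hastings' “soft threshold”
rules flip with a view-dependent probability). [cite: HirvonenRybickiSchmidSuomela2017, §2.2 (“A
distributed algorithm is a function 𝒜 that associates an output 𝒜(N) ∈ {a, b} with each local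
neighbourhood N”)] [cite: Hastings2019BoundedDepth, §3.1 (“the spin has some probability of
flipping depending on the number of neighbors which agree”)] -/
abbrev Rule (R : Type*) := Bool × ℕ → R → Bool

/-- The random cut produced by the rule: “Pick a uniform random cut `c`. For each node `v`, let
`c'(v) = 𝒜(N_c(v))`” (with the node's private randomness `r v`). [cite:
HirvonenRybickiSchmidSuomela2017, §2.2] -/
def run (A : Rule R) (c : V → Bool) (r : V → R) : V → Bool := fun v => A (view G c v) (r v)

/-- Expectation over the algorithm's randomness: a uniform colouring `c : V → Bool` and
independent uniform private symbols `r : V → R`. [cite: HirvonenRybickiSchmidSuomela2017, §2.2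
(“𝔼[w(𝒜(G))]”)] -/
def expect [Fintype R] (f : (V → Bool) → (V → R) → ℝ) : ℝ :=
  unifAvg fun c => unifAvg fun r => f c r

/-- The probability that the outputs at `u` and `v` differ. [cite: HirvonenRybickiSchmidSuomela2017,
§2.4 Lemma 2 (proof: “Pr[𝒜(N_c(u)) ≠ 𝒜(N_c(v))]”)] -/
def cutProb [Fintype R] (A : Rule R) (u v : V) : ℝ :=
  expect (R := R) fun c r => if run G A c r u ≠ run G A c r v then 1 else 0

/-- An edge is a cut edge of the 2-colouring `c'` iff its endpoints get different colours. [cite: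
HirvonenRybickiSchmidSuomela2017, §1.1 (“An edge {u,v} ∈ E is a cut edge if c(u) ≠ c(v)”)] -/
def IsCut (c' : V → Bool) (e : Sym2 V) : Prop := ¬(e.map c').IsDiag

/-- Decidability of being a cut edge (plumbing). [folklore] -/
instance (c' : V → Bool) : DecidablePred (IsCut c') := fun e =>
  inferInstanceAs (Decidable (¬(e.map c').IsDiag))

omit [Fintype V] [DecidableEq V] in
/-- An edge `s(a,b)` is cut iff the colours of `a` and `b` differ. [folklore] -/
private theorem isCut_mk (c' : V → Bool) (a b : V) : IsCut c' s(a, b) ↔ c' a ≠ c' b := by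
  simp [IsCut, Sym2.mk_isDiag_iff]

/-- The number of cut edges of a 2-colouring. [cite: HirvonenRybickiSchmidSuomela2017, §1.1] -/
def cutCount (c' : V → Bool) : ℕ := #(G.edgeFinset.filter (IsCut c'))

/-- The weight `w(c)` of a cut: the FRACTION of edges that are cut edges (“normalised so that it is
in the range [0,1]”). [cite: HirvonenRybickiSchmidSuomela2017, §1.1] -/
def cutWeight (c' : V → Bool) : ℝ := cutCount G c' / #G.edgeFinset

/-- The expected number of cut edges produced by the rule on `G`. [cite:
HirvonenRybickiSchmidSuomela2017, §2.2] -/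
def expCutCount [Fintype R] (A : Rule R) : ℝ := expect fun c r => (cutCount G (run G A c r) : ℝ)

/-- `𝔼[w(𝒜(G))]`, the expected weight of the cut produced by the rule on `G`. [cite:
HirvonenRybickiSchmidSuomela2017, §2.2 (“we are interested in the quantity 𝔼[w(𝒜(G))]”)] -/
def expCutWeight [Fintype R] (A : Rule R) : ℝ := expect fun c r => cutWeight G (run G A c r)

/-! ### The weighted neighbourhood graph (HRSS §2.3) -/

/-- `C(n, i − 1)` with the convention `C(n, −1) = 0`. [cite: HirvonenRybickiSchmidSuomela2017, §2.3
(“We follow the convention that binom(n,k) = 0 for k < 0 and k > n”)] -/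
def choosePred (n : ℕ) : ℕ → ℕ
  | 0 => 0
  | i + 1 => n.choose i

/-- `C(n,−1) = 0`. [folklore] -/
@[simp] private theorem choosePred_zero (n : ℕ) : choosePred n 0 = 0 := rfl
/-- `choosePred n (i+1) = C(n,i)`. [folklore] -/
@[simp] private theorem choosePred_succ (n i : ℕ) : choosePred n (i + 1) = n.choose i := rfl

/-- **The edge weights of the weighted neighbourhood graph `𝒩`**: `w_𝒩((k₁,i₁),(k₂,i₂)) =
4^{−d} C(d−1,i₁) C(d−1,i₂)` if `k₁ ≠ k₂` and `4^{−d} C(d−1,i₁−1) C(d−1,i₂−1)` if `k₁ = k₂`. [cite: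
HirvonenRybickiSchmidSuomela2017, §2.3 (definition of w_𝒩)] -/
def viewWeight (d : ℕ) (N₁ N₂ : Bool × ℕ) : ℝ :=
  if N₁.1 = N₂.1 then (choosePred (d - 1) N₁.2 * choosePred (d - 1) N₂.2 : ℕ) / 4 ^ d
  else ((d - 1).choose N₁.2 * (d - 1).choose N₂.2 : ℕ) / 4 ^ d

/-- The node set `V_𝒩 = {(k, i) : k ∈ {a,b}, i ∈ {0,1,…,d}}` of the neighbourhood graph (“all
possible neighbourhoods that we may encounter in d-regular triangle-free graphs … only 2d+2 possible
local neighbourhoods”). [cite: HirvonenRybickiSchmidSuomela2017, §2.3] -/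
def views (d : ℕ) : Finset (Bool × ℕ) := univ ×ˢ range (d + 1)

/-- The probability that the rule's outputs on the views `N₁`, `N₂` (with independent private
randomness) differ; for a deterministic rule this is the indicator of `𝒜(N₁) ≠ 𝒜(N₂)`. [cite:
HirvonenRybickiSchmidSuomela2017, §2.4 (“Σ_{𝒜(N₁) ≠ 𝒜(N₂)} w_𝒩(N₁,N₂)”)] -/
def disagree [Fintype R] (A : Rule R) (N₁ N₂ : Bool × ℕ) : ℝ :=
  (∑ a : R, ∑ b : R, if A N₁ a ≠ A N₂ b then (1 : ℝ) else 0) / (Fintype.card R : ℝ) ^ 2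

/-- **`w_𝒩(𝒜)`, the weight of the cut `𝒜` in the weighted neighbourhood graph** (the total weight
of the ordered pairs of views on which the outputs differ; for a randomised rule, weighted by the
disagreement probability). [cite: HirvonenRybickiSchmidSuomela2017, §2.3–§2.4 (“w(c) = Σ_{(u,v) ∈ V×V,
c(u) ≠ c(v)} w(u,v)”, “A cut of weight w_𝒩(𝒜) in the weighted neighbourhood graph 𝒩”)] -/
def ngraphWeight [Fintype R] (d : ℕ) (A : Rule R) : ℝ :=
  ∑ N₁ ∈ views d, ∑ N₂ ∈ views d, viewWeight d N₁ N₂ * disagree A N₁ N₂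

/-! ### Lemma 1: the joint law of the two views across an edge -/

omit [Fintype V] in
/-- In a triangle-free graph the neighbourhoods of the endpoints of an edge are disjoint (“As `G`
is triangle-free, sets `S_u` and `S_v` are disjoint”). [cite: HirvonenRybickiSchmidSuomela2017, §2.3
Lemma 1 (proof)] -/
theorem disjoint_neighborFinset_of_cliqueFree [Fintype V] (hG : G.CliqueFree 3) {u v : V}
    (huv : G.Adj u v) : Disjoint (G.neighborFinset u) (G.neighborFinset v) := by
  rw [Finset.disjoint_left]
  intro w hwu hwv
  rw [SimpleGraph.mem_neighborFinset] at hwu hwv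
  exact hG {u, v, w} (SimpleGraph.is3Clique_triple_iff.2 ⟨huv, hwu, hwv⟩)

/-- `ℓ_c(u) = [c(v) = c(u)] + #{y ∈ N(u) ∖ {v} : c(y) = c(u)}` for a neighbour `v` of `u`. [cite:
HirvonenRybickiSchmidSuomela2017, §2.3 Lemma 1 (proof, `u_d = v`, `S_u = {u_1,…,u_{d−1}}`)] -/
theorem likeMinded_eq {u v : V} (huv : G.Adj u v) (c : V → Bool) :
    likeMinded G c u = (if c v = c u then 1 else 0) + cnt ((G.neighborFinset u).erase v) (c u) c := by
  have hv : v ∈ G.neighborFinset u := (G.mem_neighborFinset u v).2 huv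
  change cnt (G.neighborFinset u) (c u) c = _
  conv_lhs => rw [← insert_erase hv]
  exact cnt_insert (notMem_erase v _) (c u) c

/-- **Lemma 1 (HRSS).** For an edge `{u,v}` whose endpoints have degree `d` and no common
neighbour, and a uniform random cut `c`, `ℙ[N_c(u) = N₁ and N_c(v) = N₂] = w_𝒩(N₁, N₂)` — “the
probability does not depend on the choice of graph `G` or edge `{u,v}`”. [cite:
HirvonenRybickiSchmidSuomela2017, §2.3 Lemma 1] -/
theorem prob_views_eq {d : ℕ} {u v : V} (huv : G.Adj u v) (hu : G.degree u = d) (hv : G.degree v = d)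
    (hdis : Disjoint (G.neighborFinset u) (G.neighborFinset v)) (N₁ N₂ : Bool × ℕ) :
    unifAvg (fun c : V → Bool => if view G c u = N₁ ∧ view G c v = N₂ then (1 : ℝ) else 0)
      = viewWeight d N₁ N₂ := by
  obtain ⟨k₁, i₁⟩ := N₁
  obtain ⟨k₂, i₂⟩ := N₂
  have hvu : v ∈ G.neighborFinset u := (G.mem_neighborFinset u v).2 huv
  have huv' : u ∈ G.neighborFinset v := (G.mem_neighborFinset v u).2 huv.symm
  have hne : u ≠ v := huv.ne
  have hcardu : #((G.neighborFinset u).erase v) = d - 1 := by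
    rw [card_erase_of_mem hvu, G.card_neighborFinset_eq_degree, hu]
  have hcardv : #((G.neighborFinset v).erase u) = d - 1 := by
    rw [card_erase_of_mem huv', G.card_neighborFinset_eq_degree, hv]
  have hd : 1 ≤ d := by rw [← hu, ← G.card_neighborFinset_eq_degree]; exact card_pos.2 ⟨v, hvu⟩
  -- the event as a product of four indicators with disjoint supports
  set δ : ℕ := if k₁ = k₂ then 1 else 0 with hδ
  have hsplit : ∀ c : V → Bool,
      (if view G c u = (k₁, i₁) ∧ view G c v = (k₂, i₂) then (1 : ℝ) else 0)
        = (((if c u = k₁ then (1 : ℝ) else 0) * (if c v = k₂ then (1 : ℝ) else 0))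
            * (if δ + cnt ((G.neighborFinset u).erase v) k₁ c = i₁ then (1 : ℝ) else 0))
            * (if δ + cnt ((G.neighborFinset v).erase u) k₂ c = i₂ then (1 : ℝ) else 0) := by
    intro c
    by_cases h1 : c u = k₁
    · by_cases h2 : c v = k₂
      · have hlu : likeMinded G c u = δ + cnt ((G.neighborFinset u).erase v) k₁ c := by
          rw [likeMinded_eq G huv, h1, h2, hδ]
          by_cases hk : k₁ = k₂ <;> simp [hk, eq_comm]
        have hlv : likeMinded G c v = δ + cnt ((G.neighborFinset v).erase u) k₂ c := by
          rw [likeMinded_eq G huv.symm, h1, h2, hδ]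
        simp only [view, h1, h2, hlu, hlv, Prod.mk.injEq, true_and, if_true, one_mul]
        by_cases ha : δ + cnt ((G.neighborFinset u).erase v) k₁ c = i₁ <;> by_cases hb : δ + cnt ((G.neighborFinset v).erase u) k₂ c = i₂ <;> simp [ha, hb]
      · simp [view, h2]
    · simp [view, h1]
  have hdep1 : DependsOn (fun c : V → Bool =>
      (if c u = k₁ then (1 : ℝ) else 0) * (if c v = k₂ then (1 : ℝ) else 0)) ({u} ∪ {v}) :=
    (dependsOn_apply u fun x => if x = k₁ then (1 : ℝ) else 0).mul
      (dependsOn_apply v fun x => if x = k₂ then (1 : ℝ) else 0)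
  have hdep2 := dependsOn_cnt (V := V) ((G.neighborFinset u).erase v) k₁ fun n => if δ + n = i₁ then (1 : ℝ) else 0
  have hdep3 := dependsOn_cnt (V := V) ((G.neighborFinset v).erase u) k₂ fun n => if δ + n = i₂ then (1 : ℝ) else 0
  have huSu : u ∉ ((G.neighborFinset u).erase v) := fun h => G.notMem_neighborFinset_self u (mem_of_mem_erase h)
  have hvSu : v ∉ ((G.neighborFinset u).erase v) := notMem_erase v _
  have huSv : u ∉ ((G.neighborFinset v).erase u) := notMem_erase u _
  have hvSv : v ∉ ((G.neighborFinset v).erase u) := fun h => G.notMem_neighborFinset_self v (mem_of_mem_erase h)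
  have hdisj1 : Disjoint ({u} ∪ {v}) ((G.neighborFinset u).erase v) := by
    rw [disjoint_left]; intro x hx
    rcases mem_union.1 hx with hx | hx
    · rw [mem_singleton.1 hx]; exact huSu
    · rw [mem_singleton.1 hx]; exact hvSu
  have hdisj2 : Disjoint ({u} ∪ {v} ∪ ((G.neighborFinset u).erase v)) ((G.neighborFinset v).erase u) := by
    rw [disjoint_left]; intro x hx
    rcases mem_union.1 hx with hx | hx
    · rcases mem_union.1 hx with hx | hx
      · rw [mem_singleton.1 hx]; exact huSv
      · rw [mem_singleton.1 hx]; exact hvSv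
    · exact disjoint_left.1 (disjoint_of_subset_left (erase_subset _ _)
        (disjoint_of_subset_right (erase_subset _ _) hdis)) hx
  rw [unifAvg_congr hsplit, unifAvg_mul_of_disjoint (hdep1.mul hdep2) hdep3 hdisj2,
    unifAvg_mul_of_disjoint hdep1 hdep2 hdisj1,
    unifAvg_mul_of_disjoint (dependsOn_apply u fun x => if x = k₁ then (1 : ℝ) else 0)
      (dependsOn_apply v fun x => if x = k₂ then (1 : ℝ) else 0) (disjoint_singleton.2 hne),
    unifAvg_indicator_apply, unifAvg_indicator_apply, Fintype.card_bool]
  -- the two binomial factors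
  have hbin : ∀ (S : Finset V) (k : Bool) (i : ℕ), #S = d - 1 →
      unifAvg (fun c : V → Bool => if δ + cnt S k c = i then (1 : ℝ) else 0)
        = ((if k₁ = k₂ then choosePred (d - 1) i else (d - 1).choose i : ℕ) : ℝ) / 2 ^ (d - 1) := by
    intro S k i hS
    by_cases hk : k₁ = k₂
    · simp only [hδ, hk, if_true]
      cases i with
      | zero =>
        rw [unifAvg_congr (g := fun _ => (0 : ℝ)) (fun c => by simp), unifAvg_const]
        simp
      | succ i =>
        rw [unifAvg_congr (g := fun c => if cnt S k c = i then (1 : ℝ) else 0)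
          (fun c => by simp [add_comm 1]), unifAvg_cnt_eq, hS, choosePred_succ]
    · simp only [hδ, hk, if_false, zero_add]
      rw [unifAvg_cnt_eq, hS]
  rw [hbin ((G.neighborFinset u).erase v) k₁ i₁ hcardu, hbin ((G.neighborFinset v).erase u) k₂ i₂ hcardv]
  have h4 : (4 : ℝ) ^ d = 4 * (2 ^ (d - 1) * 2 ^ (d - 1)) := by
    rw [← mul_pow, show (2 : ℝ) * 2 = 4 by norm_num, ← pow_succ', Nat.sub_add_cancel hd]
  unfold viewWeight
  by_cases hk : k₁ = k₂
  · simp only [hk, if_true, Nat.cast_mul, h4]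
    field_simp
    ring
  · simp only [hk, if_false, Nat.cast_mul, h4]
    field_simp
    ring

/-! ### Lemma 2: the expected cut weight is the cut weight in the neighbourhood graph -/

/-- Bookkeeping: a double sum of an indicator of a pair against a kernel picks out one value.
[folklore] -/
private theorem sum_sum_ite_eq_and {α γ : Type*} [DecidableEq α] [DecidableEq γ] (s : Finset α)
    (t : Finset γ) {x : α} {y : γ} (hx : x ∈ s) (hy : y ∈ t) (g : α → γ → ℝ) :
    ∑ a ∈ s, ∑ b ∈ t, (if x = a ∧ y = b then (1 : ℝ) else 0) * g a b = g x y := by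
  rw [Finset.sum_eq_single x, Finset.sum_eq_single y]
  · simp
  · intro b _ hb; simp [Ne.symm hb]
  · intro h; exact absurd hy h
  · intro a _ ha
    exact Finset.sum_eq_zero fun b _ => by simp [Ne.symm ha]
  · intro h; exact absurd hx h

omit [DecidableEq V] in
/-- A node of degree `d` has a view in `V_𝒩` (`ℓ_c(v) ≤ d`). [cite: HirvonenRybickiSchmidSuomela2017,
§2.3 (“all possible neighbourhoods that we may encounter”)] -/
theorem view_mem_views {d : ℕ} {u : V} (hu : G.degree u = d) (c : V → Bool) :
    view G c u ∈ views d := by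
  simp only [views, view, mem_product, mem_univ, true_and, mem_range]
  calc likeMinded G c u ≤ #(G.neighborFinset u) := card_filter_le _ _
    _ = d := by rw [G.card_neighborFinset_eq_degree, hu]
    _ < d + 1 := Nat.lt_succ_self d

/-- **Lemma 2 (HRSS), per edge.** For an edge `{u,v}` whose endpoints have degree `d` and no
common neighbour, the probability that the rule's outputs at `u` and `v` differ is the weight of
the (fractional) cut the rule defines in the neighbourhood graph: `Pr[𝒜(N_c(u)) ≠ 𝒜(N_c(v))] =
Σ_{N₁,N₂} w_𝒩(N₁,N₂) · Pr[outputs differ on N₁, N₂] = w_𝒩(𝒜)`. [cite: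
HirvonenRybickiSchmidSuomela2017, §2.4 Lemma 2 (proof)] -/
theorem cutProb_eq_ngraphWeight [Fintype R] [DecidableEq R] [Nonempty R] {d : ℕ} {u v : V}
    (huv : G.Adj u v) (hu : G.degree u = d) (hv : G.degree v = d)
    (hdis : Disjoint (G.neighborFinset u) (G.neighborFinset v)) (A : Rule R) :
    cutProb G A u v = ngraphWeight d A := by
  unfold cutProb expect
  have hinner : ∀ c : V → Bool,
      unifAvg (fun r : V → R => if run G A c r u ≠ run G A c r v then (1 : ℝ) else 0)
        = disagree A (view G c u) (view G c v) := fun c =>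
    unifAvg_apply_two huv.ne fun a b => if A (view G c u) a ≠ A (view G c v) b then (1 : ℝ) else 0
  have hdecomp : ∀ c : V → Bool, disagree A (view G c u) (view G c v)
      = ∑ N₁ ∈ views d, ∑ N₂ ∈ views d,
          (if view G c u = N₁ ∧ view G c v = N₂ then (1 : ℝ) else 0) * disagree A N₁ N₂ :=
    fun c => (sum_sum_ite_eq_and _ _ (view_mem_views G hu c) (view_mem_views G hv c) _).symm
  rw [unifAvg_congr hinner, unifAvg_congr hdecomp, unifAvg_finset_sum]
  refine sum_congr rfl fun N₁ _ => ?_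
  rw [unifAvg_finset_sum]
  refine sum_congr rfl fun N₂ _ => ?_
  rw [unifAvg_mul_const, prob_views_eq G huv hu hv hdis]

/-- Linearity of expectation: the expected number of cut edges is the sum over the edges of the
probability of being cut. [cite: HirvonenRybickiSchmidSuomela2017, §2.4 Lemma 2 (proof: “The claim
follows by summing over all edges {u,v} of G”)] -/
theorem expCutCount_eq_sum [Fintype R] (A : Rule R) :
    expCutCount G A
      = ∑ e ∈ G.edgeFinset, expect (R := R) (fun c r => if IsCut (run G A c r) e then (1 : ℝ) else 0) := by
  have h : ∀ (c : V → Bool) (r : V → R), (cutCount G (run G A c r) : ℝ)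
      = ∑ e ∈ G.edgeFinset, (if IsCut (run G A c r) e then (1 : ℝ) else 0) :=
    fun c r => natCast_card_filter _ _
  unfold expCutCount expect
  rw [unifAvg_congr (fun c => by rw [unifAvg_congr (h c), unifAvg_finset_sum]), unifAvg_finset_sum]

/-- The expectation of the cut indicator of `s(a,b)` is `cutProb a b`. [folklore] -/
private theorem expect_isCut_mk [Fintype R] (A : Rule R) (a b : V) :
    expect (R := R) (fun c r => if IsCut (run G A c r) s(a, b) then (1 : ℝ) else 0) = cutProb G A a b := by
  unfold cutProb expect
  exact unifAvg_congr fun c => unifAvg_congr fun r => by simp only [isCut_mk, ne_eq]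

/-- `𝔼[w] = 𝔼[#cut edges] / |E|`. [cite: HirvonenRybickiSchmidSuomela2017, §1.1 (“the weight of
the cut is normalised”)] -/
theorem expCutWeight_eq_div [Fintype R] (A : Rule R) :
    expCutWeight G A = expCutCount G A / #G.edgeFinset := by
  unfold expCutWeight expCutCount expect cutWeight
  rw [← unifAvg_div_const]
  exact unifAvg_congr fun c => unifAvg_div_const _ _

/-- **Lemma 2 (HRSS), counted: `𝔼[#cut edges of 𝒜(G)] = |E| · w_𝒩(𝒜)`** on every `d`-regular
triangle-free graph `G`. [cite: HirvonenRybickiSchmidSuomela2017, §2.4 Lemma 2] -/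
theorem expCutCount_eq [Fintype R] [DecidableEq R] [Nonempty R] {d : ℕ} (hreg : G.IsRegularOfDegree d)
    (hG : G.CliqueFree 3) (A : Rule R) :
    expCutCount G A = #G.edgeFinset * ngraphWeight d A := by
  rw [expCutCount_eq_sum]
  have h : ∀ e ∈ G.edgeFinset,
      expect (R := R) (fun c r => if IsCut (run G A c r) e then (1 : ℝ) else 0) = ngraphWeight d A := by
    intro e he
    revert he
    refine Sym2.ind (fun a b => ?_) e
    intro he
    have hab : G.Adj a b := by simpa using he
    rw [expect_isCut_mk, cutProb_eq_ngraphWeight G hab (hreg.degree_eq a) (hreg.degree_eq b)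
      (disjoint_neighborFinset_of_cliqueFree G hG hab)]
  rw [sum_congr rfl h, sum_const, nsmul_eq_mul]

/-- **Lemma 2 (HRSS): `𝔼[w(𝒜(G))] = w_𝒩(𝒜)`** — “if `𝒜` is a cut of weight `w` in neighbourhood
graph `𝒩`, then it immediately gives us a distributed algorithm that finds a cut of expected weight
`w` in ANY `d`-regular triangle-free graph” (with at least one edge). [cite:
HirvonenRybickiSchmidSuomela2017, §2.4 Lemma 2] -/
theorem expCutWeight_eq [Fintype R] [DecidableEq R] [Nonempty R] {d : ℕ}
    (hreg : G.IsRegularOfDegree d) (hG : G.CliqueFree 3) (hE : G.edgeFinset.Nonempty) (A : Rule R) :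
    expCutWeight G A = ngraphWeight d A := by
  rw [expCutWeight_eq_div, expCutCount_eq G hreg hG,
    mul_div_cancel_left₀ _ (by exact_mod_cast (card_pos.2 hE).ne')]

/-- **Existence corollary** (“As a corollary, any d-regular triangle-free graph admits a cut of at
least this size”): some 2-colouring cuts at least `|E| · w_𝒩(𝒜)` edges. [cite:
HirvonenRybickiSchmidSuomela2017, Abstract and §1.4] -/
theorem exists_cutCount_ge [Fintype R] [DecidableEq R] [Nonempty R] {d : ℕ}
    (hreg : G.IsRegularOfDegree d) (hG : G.CliqueFree 3) (A : Rule R) :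
    ∃ c' : V → Bool, #G.edgeFinset * ngraphWeight d A ≤ cutCount G c' := by
  obtain ⟨c, hc⟩ := exists_unifAvg_le (β := Bool)
    (fun c : V → Bool => unifAvg fun r : V → R => (cutCount G (run G A c r) : ℝ))
  obtain ⟨r, hr⟩ := exists_unifAvg_le (β := R) (fun r : V → R => (cutCount G (run G A c r) : ℝ))
  refine ⟨run G A c r, ?_⟩
  rw [← expCutCount_eq G hreg hG A]
  exact hc.trans hr

/-! ## Hastings' formula for spin-symmetric rules (Hastings 2019, §3.3) -/

/-- The spin `Z = ±1` of a colour. [cite: Hastings2019BoundedDepth, §3 (“Each vertex i of the graph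
corresponds to a spin σ_i = ±1, with the sign of the spin determining the cut”)] -/
def spin (b : Bool) : ℝ := if b then 1 else -1

/-- `spin true = 1`. [folklore] -/
@[simp] private theorem spin_true : spin true = 1 := rfl
/-- `spin false = −1`. [folklore] -/
@[simp] private theorem spin_false : spin false = -1 := rfl

/-- The mean output spin of the rule on a view (averaged over the private randomness). [cite:
Hastings2019BoundedDepth, §3.3 (“the value of the spin is chosen from a distribution on {−1,+1} with
expectation value equal to q(j) (v₀)_j”)] -/
def meanSpin [Fintype R] (A : Rule R) (N : Bool × ℕ) : ℝ := (∑ a : R, spin (A N a)) / Fintype.card R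

/-- For independent `±1` variables, `Pr[Z₁ ≠ Z₂] = (1 − 𝔼Z₁ 𝔼Z₂)/2`. [cite: Hastings2019BoundedDepth,
§3.3 (“the expectation value of Z_i Z_j is equal to” the product of the two means)] -/
theorem disagree_eq [Fintype R] [Nonempty R] (A : Rule R) (N₁ N₂ : Bool × ℕ) :
    disagree A N₁ N₂ = (1 - meanSpin A N₁ * meanSpin A N₂) / 2 := by
  have hm : (Fintype.card R : ℝ) ≠ 0 := ne_of_gt (by exact_mod_cast Fintype.card_pos)
  have h : ∀ a b : R, (if A N₁ a ≠ A N₂ b then (1 : ℝ) else 0)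
      = 1 / 2 - (1 / 2) * (spin (A N₁ a) * spin (A N₂ b)) := by
    intro a b
    rcases Bool.eq_false_or_eq_true (A N₁ a) with h1 | h1 <;>
      rcases Bool.eq_false_or_eq_true (A N₂ b) with h2 | h2 <;> simp [h1, h2] <;> norm_num
  unfold disagree meanSpin
  simp_rw [h, sum_sub_distrib, sum_const, card_univ, nsmul_eq_mul, ← mul_sum, ← sum_mul]
  field_simp

/-- A rule is *spin-symmetric with profile `q`* (up to `d` like-minded neighbours) when its mean
output spin on the view `(k, j)` is `q(j)` times the input spin: Hastings' class “if `j` neighbors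
agree then the value of the spin is chosen from a distribution on `{−1,+1}` with expectation value
equal to `q(j) (v₀)_i`, with `q(j) ∈ [−1,+1]`. The threshold algorithm has `q(j) ∈ {−1,+1}`”.
[cite: Hastings2019BoundedDepth, §3.3] -/
def IsSymmetric [Fintype R] (A : Rule R) (q : ℕ → ℝ) (d : ℕ) : Prop :=
  ∀ (k : Bool) (j : ℕ), j ≤ d → meanSpin A (k, j) = q j * spin k

/-- Hastings' `Σ_{n=0}^{D−1} 2^{−(D−1)} C(D−1,n) q(n)` (the mean output spin of an endpoint whose
other endpoint DISAGREES initially, `n` = number of its other neighbours that agree with it). [cite: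
Hastings2019BoundedDepth, §3.3 (second display)] -/
def hastingsA (d : ℕ) (q : ℕ → ℝ) : ℝ :=
  (∑ n ∈ range d, ((d - 1).choose n : ℝ) * q n) / 2 ^ (d - 1)

/-- Hastings' `Σ_{n=0}^{D−1} 2^{−(D−1)} C(D−1,n) q(n+1)` (the mean output spin, relative to the input
spin, of an endpoint whose other endpoint AGREES initially). [cite: Hastings2019BoundedDepth, §3.3
(first display)] -/
def hastingsB (d : ℕ) (q : ℕ → ℝ) : ℝ :=
  (∑ n ∈ range d, ((d - 1).choose n : ℝ) * q (n + 1)) / 2 ^ (d - 1)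

/-- Algebra of one block of the neighbourhood-graph sum. [folklore] -/
private theorem block_identity (s : Finset ℕ) (a b : ℕ → ℝ) (K ε : ℝ) :
    ∑ i ∈ s, ∑ j ∈ s, (a i * a j / K) * ((1 - ε * (b i * b j)) / 2)
      = ((∑ i ∈ s, a i) ^ 2 - ε * (∑ i ∈ s, a i * b i) ^ 2) / (2 * K) := by
  have h : ∀ i j, (a i * a j / K) * ((1 - ε * (b i * b j)) / 2)
      = (a i * a j) / (2 * K) - (ε / (2 * K)) * ((a i * b i) * (a j * b j)) := by
    intro i j; ring
  simp_rw [h, sum_sub_distrib, ← sum_div, ← mul_sum, ← sum_mul]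
  ring

/-- Row sum `Σ_{i ≤ d} C(d−1,i) = 2^{d−1}`. [folklore] -/
private theorem sum_range_succ_choose_pred {d : ℕ} (hd : 1 ≤ d) :
    ∑ i ∈ range (d + 1), ((d - 1).choose i : ℝ) = 2 ^ (d - 1) := by
  rw [sum_range_succ, Nat.choose_eq_zero_of_lt (by omega : d - 1 < d), Nat.cast_zero, add_zero]
  have h := Nat.sum_range_choose (d - 1)
  rw [Nat.sub_add_cancel hd] at h
  exact_mod_cast h

/-- Shifted row sum `Σ_{i ≤ d} C(d−1,i−1) = 2^{d−1}`. [folklore] -/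
private theorem sum_range_succ_choosePred {d : ℕ} (hd : 1 ≤ d) :
    ∑ i ∈ range (d + 1), (choosePred (d - 1) i : ℝ) = 2 ^ (d - 1) := by
  rw [sum_range_succ', choosePred_zero, Nat.cast_zero, add_zero]
  simp only [choosePred_succ]
  have h := Nat.sum_range_choose (d - 1)
  rw [Nat.sub_add_cancel hd] at h
  exact_mod_cast h

/-- Row sum against `q`, in terms of `hastingsA`. [folklore] -/
private theorem sum_range_succ_choose_pred_mul {d : ℕ} (hd : 1 ≤ d) (q : ℕ → ℝ) :
    ∑ i ∈ range (d + 1), ((d - 1).choose i : ℝ) * q i = 2 ^ (d - 1) * hastingsA d q := by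
  rw [sum_range_succ, Nat.choose_eq_zero_of_lt (by omega : d - 1 < d), Nat.cast_zero, zero_mul,
    add_zero, hastingsA, mul_div_cancel₀ _ (pow_ne_zero _ two_ne_zero)]

/-- Shifted row sum against `q`, in terms of `hastingsB`. [folklore] -/
private theorem sum_range_succ_choosePred_mul (d : ℕ) (q : ℕ → ℝ) :
    ∑ i ∈ range (d + 1), (choosePred (d - 1) i : ℝ) * q i = 2 ^ (d - 1) * hastingsB d q := by
  rw [sum_range_succ', choosePred_zero, Nat.cast_zero, zero_mul, add_zero, hastingsB,
    mul_div_cancel₀ _ (pow_ne_zero _ two_ne_zero)]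
  rfl

/-- **Hastings' formula.** For a spin-symmetric one-round rule with profile `q` on an edge of a
triangle-free graph whose endpoints have degree `D`, the probability that the edge is cut
(= `½ − ½ 𝔼[Z_i Z_j]`) equals `½ + ¼[(Σ_n 2^{−(D−1)} C(D−1,n) q(n))² − (Σ_n 2^{−(D−1)} C(D−1,n)
q(n+1))²]` (“averaging over choices of (v₀)_i, (v₀)_j, the expectation value of −½ Z_i Z_j equals
¼[(Σ…q(n))² − (Σ…q(n+1))²]”). [cite: Hastings2019BoundedDepth, §3.3 (third display)] -/
theorem ngraphWeight_eq_of_symmetric [Fintype R] [Nonempty R] {d : ℕ} (hd : 1 ≤ d) {A : Rule R}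
    {q : ℕ → ℝ} (hA : IsSymmetric A q d) :
    ngraphWeight d A = 1 / 2 + (hastingsA d q ^ 2 - hastingsB d q ^ 2) / 4 := by
  have h4 : (4 : ℝ) ^ d = 4 * (2 ^ (d - 1)) ^ 2 := by
    rw [show (4 : ℝ) = 2 ^ 2 by norm_num, ← pow_mul, ← pow_mul, ← pow_add]
    congr 1
    omega
  have hK : (2 : ℝ) * 4 ^ d ≠ 0 := by positivity
  -- the two kinds of blocks
  have hsame : ∀ k : Bool, ∑ i₁ ∈ range (d + 1), ∑ i₂ ∈ range (d + 1),
      viewWeight d (k, i₁) (k, i₂) * disagree A (k, i₁) (k, i₂) = (1 - hastingsB d q ^ 2) / 8 := by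
    intro k
    have hk : spin k * spin k = 1 := by cases k <;> simp
    calc _ = ∑ i₁ ∈ range (d + 1), ∑ i₂ ∈ range (d + 1),
          ((choosePred (d - 1) i₁ : ℝ) * (choosePred (d - 1) i₂) / 4 ^ d)
            * ((1 - 1 * (q i₁ * q i₂)) / 2) := by
          refine sum_congr rfl fun i₁ hi₁ => sum_congr rfl fun i₂ hi₂ => ?_
          have hq : meanSpin A (k, i₁) * meanSpin A (k, i₂) = 1 * (q i₁ * q i₂) := by
            rw [hA k i₁ (Nat.lt_succ_iff.1 (mem_range.1 hi₁)),
              hA k i₂ (Nat.lt_succ_iff.1 (mem_range.1 hi₂)), ← hk]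
            ring
          rw [disagree_eq, hq]
          simp [viewWeight]
      _ = _ := block_identity _ _ _ _ _
      _ = (1 - hastingsB d q ^ 2) / 8 := by
          rw [sum_range_succ_choosePred hd, sum_range_succ_choosePred_mul, h4]
          field_simp
          ring
  have hdiff : ∀ k : Bool, ∑ i₁ ∈ range (d + 1), ∑ i₂ ∈ range (d + 1),
      viewWeight d (k, i₁) (!k, i₂) * disagree A (k, i₁) (!k, i₂) = (1 + hastingsA d q ^ 2) / 8 := by
    intro k
    have hk : spin k * spin (!k) = -1 := by cases k <;> simp
    have hk' : k ≠ !k := by cases k <;> decide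
    calc _ = ∑ i₁ ∈ range (d + 1), ∑ i₂ ∈ range (d + 1),
          (((d - 1).choose i₁ : ℝ) * ((d - 1).choose i₂) / 4 ^ d)
            * ((1 - (-1) * (q i₁ * q i₂)) / 2) := by
          refine sum_congr rfl fun i₁ hi₁ => sum_congr rfl fun i₂ hi₂ => ?_
          have hq : meanSpin A (k, i₁) * meanSpin A (!k, i₂) = (-1) * (q i₁ * q i₂) := by
            rw [hA k i₁ (Nat.lt_succ_iff.1 (mem_range.1 hi₁)),
              hA (!k) i₂ (Nat.lt_succ_iff.1 (mem_range.1 hi₂)), ← hk]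
            ring
          rw [disagree_eq, hq]
          simp [viewWeight, hk']
      _ = _ := block_identity _ _ _ _ _
      _ = (1 + hastingsA d q ^ 2) / 8 := by
          rw [sum_range_succ_choose_pred hd, sum_range_succ_choose_pred_mul hd, h4]
          field_simp
          ring
  -- assemble the four blocks
  unfold ngraphWeight views
  rw [sum_product]
  simp_rw [sum_product]
  rw [Fintype.sum_bool]
  simp_rw [sum_comm (s := range (d + 1)) (t := (univ : Finset Bool)), Fintype.sum_bool]
  have e1 := hsame true
  have e2 := hsame false
  have e3 := hdiff true
  have e4 := hdiff false
  simp only [Bool.not_true, Bool.not_false] at e3 e4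
  rw [e1, e2, e3, e4]
  ring

/-! ## The threshold algorithm and HRSS's Lemma 3 -/

/-- **The threshold algorithm `𝒜_τ`**: “`c(v) = c₁(v)` if `ℓ(v) < τ`, the complement of `c₁(v)` if
`ℓ(v) ≥ τ`” — each node changes its mind if it has at least `τ` like-minded neighbours (one random
bit per node, one communication round). [cite: HirvonenRybickiSchmidSuomela2017, §1.4 eq. (4) and
§2.5 eq. (6)] [cite: Hastings2019BoundedDepth, §3 (“threshold algorithm”)] -/
def thresholdRule (τ : ℕ) : Rule Unit := fun N _ => if N.2 < τ then N.1 else !N.1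

/-- The spin profile of the threshold algorithm: `q(j) = +1` for `j < τ`, `−1` for `j ≥ τ`.
[cite: Hastings2019BoundedDepth, §3.3 (“The threshold algorithm has q(j) ∈ {−1,+1} for all j”)] -/
def thresholdQ (τ : ℕ) (j : ℕ) : ℝ := if j < τ then 1 else -1

/-- The threshold rule is spin-symmetric with profile `±1` (“The threshold algorithm has `q(j) ∈
{−1,+1}` for all `j`”). [cite: Hastings2019BoundedDepth, §3.3] -/
theorem thresholdRule_symmetric (τ d : ℕ) : IsSymmetric (thresholdRule τ) (thresholdQ τ) d := by
  intro k j _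
  simp only [meanSpin, thresholdRule, thresholdQ, Finset.univ_unique, Finset.sum_singleton,
    Fintype.card_unique, Nat.cast_one, div_one]
  split_ifs <;> cases k <;> simp

/-- **`α(τ, d)`**, HRSS's closed form for the performance of `𝒜_τ` in the region `τ > d/2`:
`½ + 4^{−(d−1)} C(d−1, τ−1) Σ_{i=d−τ+1}^{τ−1} C(d−1, i)`. [cite: HirvonenRybickiSchmidSuomela2017,
§2.6 Lemma 3] -/
def alpha (τ d : ℕ) : ℝ :=
  1 / 2 + ((d - 1).choose (τ - 1) * ∑ i ∈ Icc (d + 1 - τ) (τ - 1), (d - 1).choose i : ℕ) / 4 ^ (d - 1)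

/-- The numerator of `α(τ,d) − ½` as a natural number (for kernel evaluation). [cite:
HirvonenRybickiSchmidSuomela2017, §2.6 Lemma 3] -/
def alphaNum (τ d : ℕ) : ℕ := (d - 1).choose (τ - 1) * ∑ i ∈ Icc (d + 1 - τ) (τ - 1), (d - 1).choose i

/-- `α(τ,d) = ½ + alphaNum/4^{d−1}`. [cite: HirvonenRybickiSchmidSuomela2017, §2.6 Lemma 3] -/
theorem alpha_eq_alphaNum (τ d : ℕ) : alpha τ d = 1 / 2 + (alphaNum τ d : ℝ) / 4 ^ (d - 1) := rfl

/-- `A_q − B_q` for the threshold profile: only `n = τ − 1` contributes. [cite: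
HirvonenRybickiSchmidSuomela2017, §2.6 Lemma 3 (proof: “2^{d−1}(r_u − p_u) = binom(d−1, τ−1)”)] -/
theorem hastingsA_sub_hastingsB_threshold {d τ : ℕ} (hτ1 : 1 ≤ τ) (hτd : τ ≤ d) :
    hastingsA d (thresholdQ τ) - hastingsB d (thresholdQ τ) = 2 * ((d - 1).choose (τ - 1) : ℝ) / 2 ^ (d - 1) := by
  unfold hastingsA hastingsB
  rw [← sub_div, ← sum_sub_distrib]
  congr 1
  have h : ∀ n, ((d - 1).choose n : ℝ) * thresholdQ τ n - ((d - 1).choose n : ℝ) * thresholdQ τ (n + 1)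
      = if n = τ - 1 then 2 * ((d - 1).choose (τ - 1) : ℝ) else 0 := by
    intro n
    unfold thresholdQ
    by_cases hn : n = τ - 1
    · subst hn
      simp only [if_true, show τ - 1 < τ by omega, show ¬(τ - 1 + 1 < τ) by omega, if_false]
      ring
    · by_cases h1 : n < τ
      · have h2 : n + 1 < τ := by omega
        simp [hn, h1, h2]
      · have h2 : ¬(n + 1 < τ) := by omega
        simp [hn, h1, h2]
  simp_rw [h]
  rw [sum_ite_eq', if_pos (mem_range.2 (by omega))]

/-- `A_q + B_q` for the threshold profile, `d/2 < τ ≤ d`: after the reflection `i ↦ d − 1 − i` the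
two partial binomial sums leave `2 Σ_{i=d−τ+1}^{τ−1} C(d−1,i)`. [cite:
HirvonenRybickiSchmidSuomela2017, §2.6 Lemma 3 (proof: “2^{d−1}(q_u − r_u) = Σ_{i=0}^{τ−1} −
Σ_{i=0}^{d−τ} = Σ_{i=d−τ+1}^{τ−1} binom(d−1, i)”)] -/
theorem hastingsA_add_hastingsB_threshold {d τ : ℕ} (hτ1 : 1 ≤ τ) (hτd : τ ≤ d) (hdτ : d < 2 * τ) :
    hastingsA d (thresholdQ τ) + hastingsB d (thresholdQ τ)
      = 2 * (∑ i ∈ Icc (d + 1 - τ) (τ - 1), ((d - 1).choose i : ℝ)) / 2 ^ (d - 1) := by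
  unfold hastingsA hastingsB
  rw [← add_div, ← sum_add_distrib]
  congr 1
  -- pointwise: q n + q (n+1) = 2 [n+1 < τ] − 2 [τ ≤ n]
  have h : ∀ n, ((d - 1).choose n : ℝ) * thresholdQ τ n + ((d - 1).choose n : ℝ) * thresholdQ τ (n + 1)
      = 2 * (if n + 1 < τ then ((d - 1).choose n : ℝ) else 0)
        - 2 * (if τ ≤ n then ((d - 1).choose n : ℝ) else 0) := by
    intro n
    unfold thresholdQ
    by_cases h1 : n + 1 < τ
    · have h2 : n < τ := by omega
      have h3 : ¬(τ ≤ n) := by omega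
      simp [h1, h2, h3]; ring
    · by_cases h2 : τ ≤ n
      · have h3 : ¬(n < τ) := by omega
        simp [h1, h2, h3]; ring
      · have h3 : n < τ := by omega
        simp [h1, h2, h3]
  simp_rw [h]
  rw [sum_sub_distrib, ← mul_sum, ← mul_sum, ← sum_filter, ← sum_filter]
  have hF1 : (range d).filter (fun n => n + 1 < τ) = range (τ - 1) := by
    ext n; simp only [mem_filter, mem_range]; omega
  have hF2 : (range d).filter (fun n => τ ≤ n) = Ico τ d := by
    ext n; simp only [mem_filter, mem_range, mem_Ico]; omega
  rw [hF1, hF2]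
  -- reflect the second sum: Σ_{Ico τ d} C(d-1,n) = Σ_{range (d-τ)} C(d-1,n)
  have hrefl1 : ∑ n ∈ Ico τ d, ((d - 1).choose n : ℝ) = ∑ n ∈ range (d - τ), ((d - 1).choose n : ℝ) := by
    have h := Finset.sum_Ico_reflect (fun m => ((d - 1).choose m : ℝ)) τ (m := d) (n := d - 1) (by omega)
    beta_reduce at h
    rw [Nat.sub_add_cancel (by omega : 1 ≤ d), Nat.sub_self, ← range_eq_Ico] at h
    rw [← h]
    refine sum_congr rfl fun n hn => ?_
    rw [mem_Ico] at hn
    rw [Nat.choose_symm (by omega : n ≤ d - 1)]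
  -- the difference of the two initial segments is the middle segment
  have hmid : ∑ n ∈ range (τ - 1), ((d - 1).choose n : ℝ) - ∑ n ∈ range (d - τ), ((d - 1).choose n : ℝ)
      = ∑ n ∈ Ico (d - τ) (τ - 1), ((d - 1).choose n : ℝ) := by
    rw [sub_eq_iff_eq_add', range_eq_Ico, range_eq_Ico]
    exact (sum_Ico_consecutive _ (Nat.zero_le _) (by omega)).symm
  -- reflect the middle segment onto HRSS's range
  have hrefl2 : ∑ n ∈ Ico (d - τ) (τ - 1), ((d - 1).choose n : ℝ)
      = ∑ i ∈ Icc (d + 1 - τ) (τ - 1), ((d - 1).choose i : ℝ) := by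
    have h := Finset.sum_Ico_reflect (fun m => ((d - 1).choose m : ℝ)) (d - τ) (m := τ - 1)
      (n := d - 1) (by omega)
    beta_reduce at h
    have e1 : d - 1 + 1 - (τ - 1) = d + 1 - τ := by omega
    have e2 : d - 1 + 1 - (d - τ) = τ - 1 + 1 := by omega
    rw [e1, e2, Finset.Ico_add_one_right_eq_Icc] at h
    rw [← h]
    refine sum_congr rfl fun n hn => ?_
    rw [mem_Ico] at hn
    rw [Nat.choose_symm (by omega : n ≤ d - 1)]
  rw [hrefl1, ← mul_sub, hmid, hrefl2]

/-- **Lemma 3 (HRSS): the performance of the threshold algorithm.** For `τ > d/2` and an edge of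
a triangle-free graph whose endpoints have degree `d`, `Pr[edge is cut by 𝒜_τ] = α(τ, d) = ½ +
4^{−(d−1)} C(d−1, τ−1) Σ_{i=d−τ+1}^{τ−1} C(d−1, i)`. [cite: HirvonenRybickiSchmidSuomela2017, §2.6
Lemma 3] -/
theorem ngraphWeight_threshold {d τ : ℕ} (hd : 1 ≤ d) (hdτ : d < 2 * τ) :
    ngraphWeight d (thresholdRule τ) = alpha τ d := by
  rw [ngraphWeight_eq_of_symmetric hd (thresholdRule_symmetric τ d), alpha]
  congr 1
  by_cases hτd : τ ≤ d
  · have hτ1 : 1 ≤ τ := by omega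
    rw [sq_sub_sq, hastingsA_add_hastingsB_threshold hτ1 hτd hdτ,
      hastingsA_sub_hastingsB_threshold hτ1 hτd, Nat.cast_mul, Nat.cast_sum]
    have h4 : (4 : ℝ) ^ (d - 1) = 2 ^ (d - 1) * 2 ^ (d - 1) := by
      rw [← mul_pow]; norm_num
    rw [h4]
    field_simp
    ring
  · -- trivial region τ > d: the rule outputs `c` itself, both sides are ½
    have hq : ∀ n ∈ range d, ((d - 1).choose n : ℝ) * thresholdQ τ (n + 1)
        = ((d - 1).choose n : ℝ) * thresholdQ τ n := by
      intro n hn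
      rw [mem_range] at hn
      simp [thresholdQ, show n < τ by omega, show n + 1 < τ by omega]
    rw [Nat.choose_eq_zero_of_lt (by omega : d - 1 < τ - 1), zero_mul, Nat.cast_zero, zero_div,
      hastingsB, sum_congr rfl hq, ← hastingsA, sub_self, zero_div]

/-- **HRSS Lemma 3 at graph level: `𝔼[w(𝒜_τ(G))] = α(τ, d)`** for every `d`-regular triangle-free
graph with an edge and every `τ > d/2`. [cite: HirvonenRybickiSchmidSuomela2017, §2.6 Lemma 3 (with
§2.4 Lemma 2)] -/
theorem expCutWeight_threshold {d τ : ℕ} (hreg : G.IsRegularOfDegree d) (hG : G.CliqueFree 3)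
    (hE : G.edgeFinset.Nonempty) (hdτ : d < 2 * τ) :
    expCutWeight G (thresholdRule τ) = alpha τ d := by
  have hd : 1 ≤ d := by
    obtain ⟨e, he⟩ := hE
    revert he
    refine Sym2.ind (fun a b => ?_) e
    intro he
    have hab : G.Adj a b := by simpa using he
    rw [← hreg.degree_eq a, ← G.card_neighborFinset_eq_degree]
    exact card_pos.2 ⟨b, (G.mem_neighborFinset a b).2 hab⟩
  rw [expCutWeight_eq G hreg hG hE, ngraphWeight_threshold hd hdτ]

/-- **The expected NUMBER of cut edges of `𝒜_τ` is `α(τ,d) · |E|`** on every `d`-regular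
triangle-free graph (`τ > d/2`). [cite: HirvonenRybickiSchmidSuomela2017, §2.6 Lemma 3 (with §2.4
Lemma 2)] -/
theorem expCutCount_threshold {d τ : ℕ} (hd : 1 ≤ d) (hreg : G.IsRegularOfDegree d)
    (hG : G.CliqueFree 3) (hdτ : d < 2 * τ) :
    expCutCount G (thresholdRule τ) = #G.edgeFinset * alpha τ d := by
  rw [expCutCount_eq G hreg hG, ngraphWeight_threshold hd hdτ]

/-- **Existence form** (“any d-regular triangle-free graph admits a cut of at least this size”):
a 2-colouring with at least `α(τ,d) · |E|` cut edges exists, for every `τ > d/2`. [cite: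
HirvonenRybickiSchmidSuomela2017, Abstract and §1.4] -/
theorem exists_cutCount_ge_alpha {d τ : ℕ} (hd : 1 ≤ d) (hreg : G.IsRegularOfDegree d)
    (hG : G.CliqueFree 3) (hdτ : d < 2 * τ) :
    ∃ c' : V → Bool, #G.edgeFinset * alpha τ d ≤ cutCount G c' := by
  obtain ⟨c', hc'⟩ := exists_cutCount_ge G hreg hG (thresholdRule τ)
  exact ⟨c', by rwa [ngraphWeight_threshold hd hdτ] at hc'⟩

/-! ## Shearer's randomised rule is a one-round rule with two extra private bits (HRSS §1.3) -/

/-- **Shearer's algorithm** in HRSS's one-round form: with private bits `r = (c₂(v), c₃(v))`, output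
`c₁(v)` if `ℓ(v) < d/2`, `c₁(v)` if `ℓ(v) = d/2` and `c₃(v) = 0`, `c₂(v)` if `ℓ(v) = d/2` and
`c₃(v) = 1`, and `c₂(v)` if `ℓ(v) > d/2`. [cite: HirvonenRybickiSchmidSuomela2017, §1.3 eq. (1)
(Shearer 1992, as restated there)] -/
def shearerRule (d : ℕ) : Rule (Bool × Bool) := fun N r =>
  if 2 * N.2 < d then N.1 else if 2 * N.2 = d then (if r.2 then r.1 else N.1) else r.1

/-- Shearer's rule is spin-symmetric with profile `q(ℓ) = 1` (`ℓ < d/2`), `½` (`ℓ = d/2`), `0`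
(`ℓ > d/2`), so Lemma 2 and Hastings' formula give its exact performance on every `d`-regular
triangle-free graph (Shearer's lower bound `½ + √2/(8√d)` itself is not formalised here). [cite:
HirvonenRybickiSchmidSuomela2017, §1.3 eqs. (1)–(2)] -/
def shearerQ (d : ℕ) (j : ℕ) : ℝ := if 2 * j < d then 1 else if 2 * j = d then 1 / 2 else 0

/-- Shearer's rule has spin profile `1, ½, 0` according as `ℓ <, =, > d/2` (the private bits `c₂`,
`c₃` are uniform). [cite: HirvonenRybickiSchmidSuomela2017, §1.3 eq. (1)] -/
theorem shearerRule_symmetric (d d' : ℕ) : IsSymmetric (shearerRule d) (shearerQ d) d' := by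
  intro k j _
  unfold meanSpin shearerRule shearerQ
  rw [Fintype.sum_prod_type]
  simp only [Fintype.sum_bool, Fintype.card_prod, Fintype.card_bool]
  by_cases h1 : 2 * j < d
  · cases k <;> norm_num [h1]
  · by_cases h2 : 2 * j = d
    · cases k <;> norm_num [h1, h2]
    · cases k <;> norm_num [h1, h2]

/-! ## Numerical instances: HRSS's threshold `⌈(d + √d)/2⌉` and Theorem 4 for small `d` -/

/-- **HRSS's threshold `τ = ⌈(d + √d)/2⌉`.** [cite: HirvonenRybickiSchmidSuomela2017, §1.4 eq. (3)
and §2.6 (“we pick a slightly larger value τ = ⌈(d+√d)/2⌉”)] -/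
def hrssThreshold (d : ℕ) : ℕ := ⌈((d : ℝ) + Real.sqrt d) / 2⌉₊

/-- Pinning `⌈(d + √d)/2⌉ = t` by integer inequalities: `2t − 2 − d < √d ≤ 2t − d`. [folklore] -/
private theorem hrssThreshold_eq {d t : ℕ} (ht : 1 ≤ t)
    (hlo : (2 * t - 2 - d : ℤ) < 0 ∨ (2 * t - 2 - d : ℤ) ^ 2 < d)
    (hhi : (0 : ℤ) ≤ 2 * t - d ∧ (d : ℤ) ≤ (2 * t - d) ^ 2) : hrssThreshold d = t := by
  have hsd : 0 ≤ Real.sqrt d := Real.sqrt_nonneg _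
  have h1 : ((2 * t : ℝ) - 2 - d) < Real.sqrt d := by
    rcases hlo with h | h
    · have h' : ((2 * t : ℝ) - 2 - d) < 0 := by exact_mod_cast h
      linarith
    · have h' : ((2 * t : ℝ) - 2 - d) ^ 2 < d := by exact_mod_cast h
      by_cases hneg : ((2 * t : ℝ) - 2 - d) < 0
      · linarith
      · exact (Real.lt_sqrt (not_lt.1 hneg)).2 h'
  have h2 : Real.sqrt d ≤ (2 * t : ℝ) - d := by
    rw [Real.sqrt_le_iff]
    exact ⟨by exact_mod_cast hhi.1, by exact_mod_cast hhi.2⟩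
  unfold hrssThreshold
  rw [Nat.ceil_eq_iff (by omega), Nat.cast_sub ht, Nat.cast_one]
  constructor <;> linarith

/-- `9/(32√d) ≤ x` follows from `81 ≤ 1024 d x²` for `x ≥ 0`. [folklore] -/
private theorem hrss_const_le_of_sq {d : ℕ} (hd : 0 < d) {x : ℝ} (hx : 0 ≤ x)
    (h : (81 : ℝ) ≤ 1024 * d * x ^ 2) : 9 / (32 * Real.sqrt d) ≤ x := by
  have hsd : 0 < Real.sqrt d := Real.sqrt_pos.2 (by exact_mod_cast hd)
  rw [div_le_iff₀ (by positivity)]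
  have h9 : (9 : ℝ) = Real.sqrt 81 := by
    rw [show (81 : ℝ) = 9 ^ 2 by norm_num, Real.sqrt_sq (by norm_num)]
  have hsq : Real.sqrt 81 ≤ Real.sqrt ((x * (32 * Real.sqrt d)) ^ 2) :=
    Real.sqrt_le_sqrt (by rw [mul_pow, mul_pow, Real.sq_sqrt (by positivity)]; linarith)
  rw [Real.sqrt_sq (by positivity)] at hsq
  linarith

/-- From the kernel-evaluated data `⌈(d+√d)/2⌉ = t`, `alphaNum t d = m` and `81·16^{d−1} ≤ 1024 d m²`
to HRSS's bound `α(τ, d) ≥ ½ + 9/(32√d)`. [cite: HirvonenRybickiSchmidSuomela2017, §2.6 Theorem 4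
(Appendix A: “Verify cases d = 2,3,…,3000 with a computer”)] -/
theorem hrss_bound_of_data {d t m : ℕ} (hd : 0 < d) (ht : hrssThreshold d = t) (hm : alphaNum t d = m)
    (h : 81 * 16 ^ (d - 1) ≤ 1024 * d * m ^ 2) :
    1 / 2 + 9 / (32 * Real.sqrt d) ≤ alpha (hrssThreshold d) d := by
  rw [ht, alpha_eq_alphaNum, hm]
  have h16 : (0 : ℝ) < 16 ^ (d - 1) := by positivity
  have hx : (0 : ℝ) ≤ (m : ℝ) / 4 ^ (d - 1) := by positivity
  have hsq : ((m : ℝ) / 4 ^ (d - 1)) ^ 2 = (m : ℝ) ^ 2 / 16 ^ (d - 1) := by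
    rw [div_pow, ← pow_mul, mul_comm, pow_mul]
    norm_num
  have hb := hrss_const_le_of_sq hd hx (by
    rw [hsq, ← mul_div_assoc, le_div_iff₀ h16]
    exact_mod_cast h)
  linarith

/-- **Theorem 4 (HRSS) for `2 ≤ d ≤ 10`: `α(⌈(d+√d)/2⌉, d) ≥ ½ + 9/(32√d) = ½ + 0.28125/√d`.**
The paper proves it for all `d ≥ 2` (computer check for `d ≤ 3000`, binomial estimates beyond); here
the cases `d ≤ 10` are evaluated in the kernel, with `⌈(d+√d)/2⌉ = 2,3,3,4,5,5,6,6,7`. NOT formalised: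
`d ≥ 11`. [cite: HirvonenRybickiSchmidSuomela2017, §1.4 eq. (5) and §2.6 Theorem 4] -/
theorem hrss_theorem4_small : ∀ d : ℕ, d ∈ Finset.Icc 2 10 →
    1 / 2 + 9 / (32 * Real.sqrt d) ≤ alpha (hrssThreshold d) d := by
  intro d hd
  rw [Finset.mem_Icc] at hd
  obtain ⟨hd2, hd10⟩ := hd
  interval_cases d
  · exact hrss_bound_of_data (t := 2) (m := 1) (by norm_num)
      (hrssThreshold_eq (by norm_num) (by decide) (by decide)) (by decide) (by decide)
  · exact hrss_bound_of_data (t := 3) (m := 3) (by norm_num)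
      (hrssThreshold_eq (by norm_num) (by decide) (by decide)) (by decide) (by decide)
  · exact hrss_bound_of_data (t := 3) (m := 9) (by norm_num)
      (hrssThreshold_eq (by norm_num) (by decide) (by decide)) (by decide) (by decide)
  · exact hrss_bound_of_data (t := 4) (m := 40) (by norm_num)
      (hrssThreshold_eq (by norm_num) (by decide) (by decide)) (by decide) (by decide)
  · exact hrss_bound_of_data (t := 5) (m := 125) (by norm_num)
      (hrssThreshold_eq (by norm_num) (by decide) (by decide)) (by decide) (by decide)
  · exact hrss_bound_of_data (t := 5) (m := 525) (by norm_num)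
      (hrssThreshold_eq (by norm_num) (by decide) (by decide)) (by decide) (by decide)
  · exact hrss_bound_of_data (t := 6) (m := 1911) (by norm_num)
      (hrssThreshold_eq (by norm_num) (by decide) (by decide)) (by decide) (by decide)
  · exact hrss_bound_of_data (t := 6) (m := 7056) (by norm_num)
      (hrssThreshold_eq (by norm_num) (by decide) (by decide)) (by decide) (by decide)
  · exact hrss_bound_of_data (t := 7) (m := 28224) (by norm_num)
      (hrssThreshold_eq (by norm_num) (by decide) (by decide)) (by decide) (by decide)

/-- **`d = 3`: the optimal one-round algorithm is the threshold rule with `τ = 3`**, of value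
`α(3,3) = 11/16` (“For d = 3, the heaviest cut 𝒜_opt of 𝒩 is: k if i < 3, the complement if
i ≥ 3 … Note that τ₃ = 3”; optimality over all rules is the max-SAT computation of §2.5, not redone
here). [cite: HirvonenRybickiSchmidSuomela2017, §2.5 eq. (5) and Remark 1] -/
theorem alpha_three : alpha 3 3 = 11 / 16 := by
  rw [alpha_eq_alphaNum, show alphaNum 3 3 = 3 by decide]
  norm_num

/-- `d = 2` (cycles of length ≥ 4): `α(2, 2) = 3/4`. [cite: HirvonenRybickiSchmidSuomela2017, §2.6
Lemma 3 (evaluated)] -/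
theorem alpha_two : alpha 2 2 = 3 / 4 := by
  rw [alpha_eq_alphaNum, show alphaNum 2 2 = 1 by decide]
  norm_num

end Model

/-! ## Valued one-round rules: Hastings' local tensor algorithms with a discrete initial distribution (§3.2–§3.3)

Hastings' one-step “local tensor algorithm” draws i.i.d. initial values `(v₀)_i` from a finite set,
forms `v₁ = v₀ + c J v₀` (on a graph, `(J v₀)_i = −Σ_{j ∼ i} (v₀)_j`) and outputs `Z_i = sign (v₁)_i`
(§3: “we apply a single linear transformation … `v⃗₁ = v⃗₀ + c₀ J · v⃗₀`. Finally … we choose `Z_i` to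
equal the sign of `(v⃗_a)_i`”; §3.3: “we can approximate the continuous distribution by a discrete
distribution; a simple approximation such as choosing uniformly from `{−1, −1/3, +1/3, +1}` gives an
algorithm whose performance can be exactly enumerated”). We type the general shape: i.i.d. uniform
symbols `x_v ∈ β`, integer weights `φ : β → ℤ`, and an output bit `F (x_v) (Σ_{w ∼ v} φ(x_w))`; the
threshold rules above are the case `β = Bool`. As for Lemma 2, on an edge of a triangle-free graph whose
endpoints have degree `D` the cut probability is a graph-independent finite average (“one simply needs
to compute the expectation value of `Z_i Z_j` given a random initial assignment `v₀` to the spins on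
that subgraph … a graph with `2D` vertices”). -/

section Valued

variable {V : Type*} [Fintype V] [DecidableEq V] (G : _root_.SimpleGraph V) [DecidableRel G.Adj]
variable {β : Type*} [Fintype β] [DecidableEq β]

/-- `Σ_{w ∼ v} φ(x_w)` — the entry `(J · v⃗₀)_v` up to sign. [cite: Hastings2019BoundedDepth, §3
(“`v⃗₁ = v⃗₀ + c₀ J · v⃗₀`”)] -/
def nbrSum (φ : β → ℤ) (x : V → β) (v : V) : ℤ := ∑ w ∈ G.neighborFinset v, φ (x w)

/-- The cut produced by a valued one-round rule: node `v` outputs `F (x_v) (Σ_{w∼v} φ(x_w))`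
(Hastings: `Z_i = sign((v⃗₁)_i)`). [cite: Hastings2019BoundedDepth, §3 (“we choose `Z_i` to equal the
sign of `(v⃗_a)_i`”)] -/
def vrun (φ : β → ℤ) (F : β → ℤ → Bool) (x : V → β) : V → Bool := fun v => F (x v) (nbrSum G φ x v)

/-- The probability (uniform i.i.d. symbols) that the valued rule's outputs on `u`, `v` differ.
[cite: Hastings2019BoundedDepth, §3.3 (“To compute the expectation value of `Z_i Z_j`”)] -/
def vcutProb (φ : β → ℤ) (F : β → ℤ → Bool) (u v : V) : ℝ :=
  unifAvg fun x : V → β => if vrun G φ F x u ≠ vrun G φ F x v then (1 : ℝ) else 0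

/-- The expected number of cut edges of the valued rule. [cite: Hastings2019BoundedDepth, §3 (“the
number of edges cut … `½ N_e + ¼ σ⃗·J·σ⃗`”)] -/
def vexpCutCount (φ : β → ℤ) (F : β → ℤ → Bool) : ℝ :=
  unifAvg fun x : V → β => (cutCount G (vrun G φ F x) : ℝ)

/-- The expected cut weight (fraction of cut edges) of the valued rule. [cite: Hastings2019BoundedDepth,
§3 (“expected fraction of edges cut”)] -/
def vexpCutWeight (φ : β → ℤ) (F : β → ℤ → Bool) : ℝ :=
  unifAvg fun x : V → β => cutWeight G (vrun G φ F x)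

/-- The graph-independent local quantity: the mean output spin of an endpoint whose own symbol is `a`
and whose partner across the edge has symbol `b`, averaged over the i.i.d. symbols of its `D − 1`
further neighbours. [cite: Hastings2019BoundedDepth, §3.3 (“the expectation only depends on the sum of
`(v⃗₀)_k` over `k ≠ j` which are neighbors of `i` … and also of course `(v⃗₀)_i` and `(v⃗₀)_j`”)] -/
def localMean (D : ℕ) (φ : β → ℤ) (F : β → ℤ → Bool) (a b : β) : ℝ :=
  unifAvg fun s : Fin (D - 1) → β => spin (F a (φ b + ∑ i, φ (s i)))

omit [Fintype V] [DecidableEq V] [Fintype β] [DecidableEq β] in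
/-- A function of the `S`-sum depends only on `S`. [folklore] -/
private theorem dependsOn_nbr (S : Finset V) (φ : β → ℤ) (ψ : ℤ → ℝ) :
    DependsOn (fun x : V → β => ψ (∑ w ∈ S, φ (x w))) S := by
  intro x x' h
  show ψ (∑ w ∈ S, φ (x w)) = ψ (∑ w ∈ S, φ (x' w))
  rw [sum_congr rfl fun w hw => by rw [h w hw]]

omit [DecidableEq β] in
/-- Averaging over `Fin (m+1) → β` one coordinate at a time. [folklore] -/
private theorem unifAvg_fin_succ [Nonempty β] (m : ℕ) (f : (Fin (m + 1) → β) → ℝ) :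
    unifAvg f = (∑ a : β, unifAvg (fun s : Fin m → β => f (Fin.cons a s))) / Fintype.card β := by
  have hsum : ∑ s : Fin (m + 1) → β, f s = ∑ a : β, ∑ s : Fin m → β, f (Fin.cons a s) := by
    rw [← Equiv.sum_comp (Fin.consEquiv fun _ => β) f, Fintype.sum_prod_type]
    rfl
  unfold unifAvg
  rw [hsum, Fintype.card_fun, Fintype.card_fun, Fintype.card_fin, Fintype.card_fin, pow_succ]
  push_cast
  rw [← sum_div, div_div]

/-- **Transport**: the law of `Σ_{w ∈ S} φ(x_w)` under i.i.d. uniform symbols depends only on `|S|`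
— the average of any function of it equals the average over `Fin |S| → β`. [folklore] -/
private theorem unifAvg_sum_transport [Nonempty β] (φ : β → ℤ) (S : Finset V) {m : ℕ} (hS : #S = m)
    (H : ℤ → ℝ) :
    unifAvg (fun x : V → β => H (∑ w ∈ S, φ (x w)))
      = unifAvg (fun s : Fin m → β => H (∑ i, φ (s i))) := by
  induction S using Finset.induction_on generalizing m H with
  | empty =>
    subst hS
    simp [unifAvg_const]
  | @insert y S hy ih =>
    rw [card_insert_of_notMem hy] at hS
    subst hS
    have hL : ∀ x : V → β, H (∑ w ∈ insert y S, φ (x w))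
        = ∑ a : β, (if x y = a then (1 : ℝ) else 0) * H (φ a + ∑ w ∈ S, φ (x w)) := by
      intro x
      rw [sum_insert hy]
      symm
      rw [Finset.sum_eq_single (x y)]
      · simp
      · intro a _ ha; simp [Ne.symm ha]
      · simp
    rw [unifAvg_congr hL, unifAvg_finset_sum, unifAvg_fin_succ, sum_div]
    refine sum_congr rfl fun a _ => ?_
    rw [unifAvg_mul_of_disjoint (dependsOn_apply y fun b => if b = a then (1 : ℝ) else 0)
      (dependsOn_nbr S φ fun z => H (φ a + z)) (disjoint_singleton_left.2 hy),
      unifAvg_indicator_apply, ih rfl (fun z => H (φ a + z))]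
    simp only [Fin.sum_univ_succ, Fin.cons_zero, Fin.cons_succ]
    ring

omit [Fintype β] [DecidableEq β] in
/-- `nbrSum` at `u` splits off the partner `v`: `Σ_{w∼u} φ(x_w) = φ(x_v) + Σ_{w ∈ N(u)∖{v}} φ(x_w)`.
[cite: Hastings2019BoundedDepth, §3.3] -/
theorem nbrSum_eq {u v : V} (huv : G.Adj u v) (φ : β → ℤ) (x : V → β) :
    nbrSum G φ x u = φ (x v) + ∑ w ∈ (G.neighborFinset u).erase v, φ (x w) := by
  unfold nbrSum
  rw [← add_sum_erase _ _ ((G.mem_neighborFinset u v).2 huv)]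

/-- **The cut probability of a valued one-round rule on an edge of a triangle-free graph**: for `u ∼ v`
with `deg u = deg v = D` and no common neighbour, `Pr[Z_u ≠ Z_v] = ½ − ½ 𝔼[Z_u Z_v]` with `𝔼[Z_u Z_v]
= |β|⁻² Σ_{a,b} m(a,b) m(b,a)`, `m = localMean D φ F` (conditional independence of the two sides given
`(x_u, x_v)`). [cite: Hastings2019BoundedDepth, §3.3 (“the probability distribution … on any pair of
neighboring spins `i, j` can be computed given the initial distribution of the neighbors of those
spins”)] -/
theorem vcutProb_eq [Nonempty β] {D : ℕ} {u v : V} (huv : G.Adj u v) (hu : G.degree u = D)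
    (hv : G.degree v = D) (hdis : Disjoint (G.neighborFinset u) (G.neighborFinset v))
    (φ : β → ℤ) (F : β → ℤ → Bool) :
    vcutProb G φ F u v = 1 / 2 - (∑ a, ∑ b, localMean D φ F a b * localMean D φ F b a)
      / (2 * (Fintype.card β : ℝ) ^ 2) := by
  have hvu : v ∈ G.neighborFinset u := (G.mem_neighborFinset u v).2 huv
  have huv' : u ∈ G.neighborFinset v := (G.mem_neighborFinset v u).2 huv.symm
  have hne : u ≠ v := huv.ne
  have hcardu : #((G.neighborFinset u).erase v) = D - 1 := by
    rw [card_erase_of_mem hvu, G.card_neighborFinset_eq_degree, hu]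
  have hcardv : #((G.neighborFinset v).erase u) = D - 1 := by
    rw [card_erase_of_mem huv', G.card_neighborFinset_eq_degree, hv]
  -- step 1: indicator = ½ − ½ Z_u Z_v
  have h1 : ∀ x : V → β, (if vrun G φ F x u ≠ vrun G φ F x v then (1 : ℝ) else 0)
      = 1 / 2 - 1 / 2 * (spin (vrun G φ F x u) * spin (vrun G φ F x v)) := by
    intro x
    rcases Bool.eq_false_or_eq_true (vrun G φ F x u) with h | h <;>
      rcases Bool.eq_false_or_eq_true (vrun G φ F x v) with h' | h' <;> simp [h, h'] <;> norm_num
  -- step 2: decompose by the values at u and v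
  set fu : β → β → (V → β) → ℝ := fun a b x =>
    spin (F a (φ b + ∑ w ∈ (G.neighborFinset u).erase v, φ (x w))) with hfu
  set fv : β → β → (V → β) → ℝ := fun a b x =>
    spin (F b (φ a + ∑ w ∈ (G.neighborFinset v).erase u, φ (x w))) with hfv
  have h2 : ∀ x : V → β, spin (vrun G φ F x u) * spin (vrun G φ F x v)
      = ∑ a, ∑ b, ((if x u = a then (1 : ℝ) else 0) * (if x v = b then (1 : ℝ) else 0))
          * fu a b x * fv a b x := by
    intro x
    symm
    rw [Finset.sum_eq_single (x u)]
    · rw [Finset.sum_eq_single (x v)]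
      · simp only [if_true, one_mul, hfu, hfv, vrun, nbrSum_eq G huv, nbrSum_eq G huv.symm]
      · intro b _ hb; simp [Ne.symm hb]
      · simp
    · intro a _ ha; exact Finset.sum_eq_zero fun b _ => by simp [Ne.symm ha]
    · simp
  -- supports
  have huSu : u ∉ (G.neighborFinset u).erase v := fun h => G.notMem_neighborFinset_self u (mem_of_mem_erase h)
  have hvSu : v ∉ (G.neighborFinset u).erase v := notMem_erase v _
  have huSv : u ∉ (G.neighborFinset v).erase u := notMem_erase u _
  have hvSv : v ∉ (G.neighborFinset v).erase u := fun h => G.notMem_neighborFinset_self v (mem_of_mem_erase h)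
  have hdisj1 : Disjoint ({u} ∪ {v}) ((G.neighborFinset u).erase v) := by
    rw [disjoint_left]; intro w hw
    rcases mem_union.1 hw with hw | hw
    · rw [mem_singleton.1 hw]; exact huSu
    · rw [mem_singleton.1 hw]; exact hvSu
  have hdisj2 : Disjoint ({u} ∪ {v} ∪ (G.neighborFinset u).erase v) ((G.neighborFinset v).erase u) := by
    rw [disjoint_left]; intro w hw
    rcases mem_union.1 hw with hw | hw
    · rcases mem_union.1 hw with hw | hw
      · rw [mem_singleton.1 hw]; exact huSv
      · rw [mem_singleton.1 hw]; exact hvSv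
    · exact disjoint_left.1 (disjoint_of_subset_left (erase_subset _ _)
        (disjoint_of_subset_right (erase_subset _ _) hdis)) hw
  have hind : ∀ a b : β, unifAvg (fun x : V → β =>
      ((if x u = a then (1 : ℝ) else 0) * (if x v = b then (1 : ℝ) else 0)) * fu a b x * fv a b x)
      = 1 / Fintype.card β * (1 / Fintype.card β) * (localMean D φ F a b * localMean D φ F b a) := by
    intro a b
    have hdep1 : DependsOn (fun x : V → β =>
        (if x u = a then (1 : ℝ) else 0) * (if x v = b then (1 : ℝ) else 0)) ({u} ∪ {v}) :=
      (dependsOn_apply u fun c => if c = a then (1 : ℝ) else 0).mul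
        (dependsOn_apply v fun c => if c = b then (1 : ℝ) else 0)
    have hdep2 : DependsOn (fu a b) ((G.neighborFinset u).erase v) :=
      dependsOn_nbr _ φ fun z => spin (F a (φ b + z))
    have hdep3 : DependsOn (fv a b) ((G.neighborFinset v).erase u) :=
      dependsOn_nbr _ φ fun z => spin (F b (φ a + z))
    rw [unifAvg_mul_of_disjoint (hdep1.mul hdep2) hdep3 hdisj2,
      unifAvg_mul_of_disjoint hdep1 hdep2 hdisj1,
      unifAvg_mul_of_disjoint (dependsOn_apply u fun c => if c = a then (1 : ℝ) else 0)
        (dependsOn_apply v fun c => if c = b then (1 : ℝ) else 0) (disjoint_singleton.2 hne),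
      unifAvg_indicator_apply, unifAvg_indicator_apply,
      unifAvg_sum_transport φ _ hcardu (fun z => spin (F a (φ b + z))),
      unifAvg_sum_transport φ _ hcardv (fun z => spin (F b (φ a + z)))]
    simp only [localMean]
    ring
  rw [vcutProb, unifAvg_congr h1, unifAvg_sub, unifAvg_const, unifAvg_const_mul, unifAvg_congr h2,
    unifAvg_finset_sum]
  simp_rw [unifAvg_finset_sum, hind]
  have hβ : (Fintype.card β : ℝ) ≠ 0 := ne_of_gt (by exact_mod_cast Fintype.card_pos)
  have hsum : ∑ a, ∑ b, 1 / (Fintype.card β : ℝ) * (1 / Fintype.card β)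
      * (localMean D φ F a b * localMean D φ F b a)
      = (∑ a, ∑ b, localMean D φ F a b * localMean D φ F b a) / (Fintype.card β : ℝ) ^ 2 := by
    rw [sum_div]
    refine sum_congr rfl fun a _ => ?_
    rw [sum_div]
    refine sum_congr rfl fun b _ => ?_
    field_simp
  rw [hsum]
  field_simp

omit [DecidableEq β] in
/-- Linearity: the expected number of cut edges of a valued rule is the sum over the edges of the cut
probabilities. [cite: Hastings2019BoundedDepth, §3.3] -/
theorem vexpCutCount_eq_sum (φ : β → ℤ) (F : β → ℤ → Bool) :
    vexpCutCount G φ F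
      = ∑ e ∈ G.edgeFinset, unifAvg (fun x : V → β => if IsCut (vrun G φ F x) e then (1 : ℝ) else 0) := by
  have h : ∀ x : V → β, (cutCount G (vrun G φ F x) : ℝ)
      = ∑ e ∈ G.edgeFinset, (if IsCut (vrun G φ F x) e then (1 : ℝ) else 0) :=
    fun x => natCast_card_filter _ _
  unfold vexpCutCount
  rw [unifAvg_congr h, unifAvg_finset_sum]

/-- **The expected number of cut edges of a valued one-round rule on a `D`-regular triangle-free graph
is `|E|` times the graph-independent edge probability** `½ − Σ_{a,b} m(a,b) m(b,a)/(2|β|²)`, `m =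
localMean D φ F` (the valued analogue of HRSS's Lemma 2). [cite: Hastings2019BoundedDepth, §3.3 (“All
these algorithms (QAOA and local tensor algorithms with a single step) on triangle-free graphs can be
analyzed very simply”)] -/
theorem vexpCutCount_eq [Nonempty β] {D : ℕ} (hreg : G.IsRegularOfDegree D) (hG : G.CliqueFree 3)
    (φ : β → ℤ) (F : β → ℤ → Bool) :
    vexpCutCount G φ F = #G.edgeFinset * (1 / 2 - (∑ a, ∑ b, localMean D φ F a b * localMean D φ F b a)
      / (2 * (Fintype.card β : ℝ) ^ 2)) := by
  rw [vexpCutCount_eq_sum]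
  have h : ∀ e ∈ G.edgeFinset, unifAvg (fun x : V → β => if IsCut (vrun G φ F x) e then (1 : ℝ) else 0)
      = 1 / 2 - (∑ a, ∑ b, localMean D φ F a b * localMean D φ F b a)
          / (2 * (Fintype.card β : ℝ) ^ 2) := by
    intro e he
    revert he
    refine Sym2.ind (fun a b => ?_) e
    intro he
    have hab : G.Adj a b := by simpa using he
    rw [← vcutProb_eq G hab (hreg.degree_eq a) (hreg.degree_eq b)
      (disjoint_neighborFinset_of_cliqueFree G hG hab) φ F, vcutProb]
    exact unifAvg_congr fun x => by simp only [isCut_mk, ne_eq]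
  rw [sum_congr rfl h, sum_const, nsmul_eq_mul]

/-- `𝔼[w] = ½ − Σ_{a,b} m(a,b) m(b,a)/(2|β|²)` for the cut weight of a valued rule on a `D`-regular
triangle-free graph with an edge. [cite: Hastings2019BoundedDepth, §3.3] -/
theorem vexpCutWeight_eq [Nonempty β] {D : ℕ} (hreg : G.IsRegularOfDegree D) (hG : G.CliqueFree 3)
    (hE : G.edgeFinset.Nonempty) (φ : β → ℤ) (F : β → ℤ → Bool) :
    vexpCutWeight G φ F = 1 / 2 - (∑ a, ∑ b, localMean D φ F a b * localMean D φ F b a)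
      / (2 * (Fintype.card β : ℝ) ^ 2) := by
  have h : vexpCutWeight G φ F = vexpCutCount G φ F / #G.edgeFinset := by
    unfold vexpCutWeight vexpCutCount cutWeight
    exact unifAvg_div_const _ _
  rw [h, vexpCutCount_eq G hreg hG, mul_div_cancel_left₀ _ (by exact_mod_cast (card_pos.2 hE).ne')]

/-! ### Integer form for kernel evaluation (“these cases can be enumerated on computer”) -/

/-- The spin of a colour as an integer. [cite: Hastings2019BoundedDepth, §3] -/
def spinZ (b : Bool) : ℤ := if b then 1 else -1

omit [Fintype V] [DecidableEq V] [Fintype β] [DecidableEq β] in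
/-- `spinZ` casts to `spin`. [folklore] -/
private theorem cast_spinZ (b : Bool) : ((spinZ b : ℤ) : ℝ) = spin b := by
  cases b <;> simp [spinZ, spin]

/-- `|β|^{D−1} · localMean` as an integer: the sum of the output spins over all symbol strings of the
`D − 1` further neighbours. [cite: Hastings2019BoundedDepth, §3.3 (“there are a finite number of cases
to consider. These cases can be enumerated on computer”)] -/
def localSumZ (D : ℕ) (φ : β → ℤ) (F : β → ℤ → Bool) (a b : β) : ℤ :=
  ∑ s : Fin (D - 1) → β, spinZ (F a (φ b + ∑ i, φ (s i)))

/-- The integer `Σ_{a,b} localSumZ(a,b) · localSumZ(b,a)` (`= |β|^{2D} 𝔼[Z_i Z_j]`). [cite: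
Hastings2019BoundedDepth, §3.3] -/
def pairSumZ (D : ℕ) (φ : β → ℤ) (F : β → ℤ → Bool) : ℤ :=
  ∑ a : β, ∑ b : β, localSumZ D φ F a b * localSumZ D φ F b a

omit [DecidableEq β] in
/-- `localMean = localSumZ / |β|^{D−1}`. [cite: Hastings2019BoundedDepth, §3.3] -/
theorem localMean_eq (D : ℕ) (φ : β → ℤ) (F : β → ℤ → Bool) (a b : β) :
    localMean D φ F a b = (localSumZ D φ F a b : ℝ) / (Fintype.card β : ℝ) ^ (D - 1) := by
  unfold localMean localSumZ unifAvg
  rw [Fintype.card_fun, Fintype.card_fin]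
  push_cast
  simp_rw [cast_spinZ]

/-- **Integer form of the edge count**: on a `D`-regular triangle-free graph (`D ≥ 1`) a valued rule
cuts `|E| · (½ − pairSumZ/(2|β|^{2D}))` edges in expectation. [cite: Hastings2019BoundedDepth, §3.3] -/
theorem vexpCutCount_eq_int [Nonempty β] {D : ℕ} (hD : 1 ≤ D) (hreg : G.IsRegularOfDegree D)
    (hG : G.CliqueFree 3) (φ : β → ℤ) (F : β → ℤ → Bool) :
    vexpCutCount G φ F = #G.edgeFinset *
      (1 / 2 - (pairSumZ D φ F : ℝ) / (2 * (Fintype.card β : ℝ) ^ (2 * D))) := by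
  rw [vexpCutCount_eq G hreg hG]
  congr 1
  unfold pairSumZ
  simp_rw [localMean_eq]
  push_cast
  have hβ : (Fintype.card β : ℝ) ≠ 0 := ne_of_gt (by exact_mod_cast Fintype.card_pos)
  have hpow : (Fintype.card β : ℝ) ^ (2 * D) = (Fintype.card β : ℝ) ^ 2 *
      ((Fintype.card β : ℝ) ^ (D - 1) * (Fintype.card β : ℝ) ^ (D - 1)) := by
    rw [← pow_add, ← pow_add]
    congr 1
    omega
  rw [hpow]
  congr 1
  simp_rw [div_mul_div_comm, ← Finset.sum_div]
  rw [div_div]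
  congr 1
  ring

end Valued

end Literature.Combinatorics.SimpleGraph.TriangleFreeLocalCut
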